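import Summits.QuantumFields.YangMills.Theses.FradkinShenkerFlow
import Summits.QuantumFields.YangMills.Theorems.HypercubicLimit.Negative.AllTimesGapFalse
import Summits.QuantumFields.YangMills.Theorems.CurvatureBoostCovariance.Negative.BetaZeroTie
import Summits.QuantumFields.YangMills.Theorems.LatticeGapOnTrajectory.Negative.ZeroCouplingGap
import Literature.MathematicalPhysics.QuantumLattice.GaugeGroupsProofs
import Summits.QuantumFields.YangMills.Theses.EquipartitionCriticality
import Summits.QuantumFields.YangMills.Theses.DirichletWindow
import Summits.QuantumFields.YangMills.Theses.ConvexGribovBody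
import Literature.Probability.LatticeModels.OSReconstruction
import Literature.MathematicalPhysics.QuantumFieldTheory.QCDSlabFunctional
import Literature.MathematicalPhysics.QuantumLattice.LatticeGaugeDLR

/-!
# Disproof of `ClusteringToYangMills` (stmt-QuantumFields-9443) — standing adversary work file (cdisprove, gen 1–3)

Crux item `stmt-QuantumFields-9443` = `Summit.QuantumFields.YangMills.Theses.FradkinShenkerFlow.ClusteringToYangMills`,
the rank-4 IMPORTED COMPLEMENT of route `FradkinShenkerFlow` (rev 5):

  `LatticeClustering → YangMills`, where `LatticeClustering` := for every compact simple `G` and every faithful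
  unitary lattice representation `r` there is `β₀` such that for every `β ≥ β₀` the torus Wilson measures cluster
  exponentially in Euclidean time, uniformly in the volume: `∃ m > 0 ∀ A B ∃ C ∀ S, ∀ n ≤ S,
  |⟨A · τ_{n e₀} B⟩_{β,2S+1} − ⟨A⟩⟨B⟩| ≤ C e^{−m n}` (`EC G r β` below).

Prose lives only in docstrings; every `theorem` below is checked (rc 0, no `sorry`).

LANDED in the tree (prover-importable, `--supports stmt-QuantumFields-9443`, namespace
`Summit.QuantumFields.YangMills.Theorems.ClusteringToYangMills.Negative`):
* `Theorems/ClusteringToYangMills/Negative/DisproofBurden.lean` — p73406, commit 27fe311ef14d: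
  `su2_clustering_of_not_clusteringToYangMills`, `clustering_perVolume`, `not_clusteringAllTimes_at`,
  `not_latticeClusteringAllTimes`, `clustering_zero_coupling`, `yangMillsShape_without_nontriviality`,
  `not_isNontrivial_of_frequently_beta_zero'`, `yangMills_witness_beta_ne_zero` (§0–§2 below, def-free forms).
* (gen 2, cycle 2) `Theorems/ClusteringToYangMills/Negative/AdapterNonSoftness.lean` — p75909 ACCEPTED, commit 0b456dad293c:
  `abstract_adapter_false` with its witness lemmas (§3b below, def-free: local notations).
* (gen 2, cycle 2) `Theorems/ClusteringToYangMills/Negative/AdapterCover.lean` — p76337 ACCEPTED, commit 319214811d4f: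
  `rate_sacrifice`, `uniformShape_of_cover` (no-threshold form of §3c `absUTG_of_cover`),
  `uniformShape_along_sequence` (free along sequences), `not_continuumLegGivenGap_of_not_clusteringToYangMills`,
  `not_dockInputs_of_not_clusteringToYangMills` (§4 below).

## VERDICT (cycles 1–3): the CRUX RESISTS — irrefutable short of refuting the typed Clay statement;
## the picked LINE has a false stub (GV) for gauge groups with `π₁(G) ≠ 0` (§5, cycle 3)

Cycle 3 (gen 3) adds §5: the lead picked `spectral-requantisation-dock` and registered seven stubs;
their vocabulary is reproduced verbatim (`SRD.*`), the `μ`-free OS premises of the line's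
`(Θ, τ, 𝓔₊)` are PROVED (§5a: shift sign, involution, half-space exchange — no junk in any
definition; `β = 0` consistency of GV/T¼/BD checked on paper), and `stub_gapStability` (GV) is
shown FALSE for every simple `G` with `π₁(G) ≠ 0` ('t Hooft twist sectors: `|π₁(G)|³`
near-degenerate cylinder vacua, splitting `→ 0` with the volume) by the checked composition
`SRD.stub_gapStability_false_of_twistVacuaDegenerate : TwistVacuaDegenerate r β → MassivePhase r β →
¬ stub_gapStability` — the two hypotheses being the standard weak-coupling physics of `SO(3)` LGT
(not constructible here; evidence note `stub-misstated: stub_gapStability` filed for the lead with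
the repair `CylGapModSectors`).  The crux is not touched by this: local observables are blind to
global flux.


Cycle 2 (gen 2) adds §3 (the dock line's ADAPTER, the expected stub: `StructuredH ↔ UniformTorusGap`;
ABSTRACT NON-SOFTNESS over real β by a Baire-category witness family; exact residual = countable uniform
cover) and §4 (burden update: `¬crux ⇒ ¬8782` and `¬crux ⇒ ¬(adapter ∧ 8941 ∧ 12318 ∧ 8762)`).  The crux
itself is untouched by all of it: its truth value remains `YangMills ∨ ¬LatticeClustering`.

`not_crux_iff` : `¬ ClusteringToYangMills ↔ LatticeClustering ∧ ¬ YangMills`.  A disproof must (i) PROVE the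
weak-coupling lattice mass gap (volume-uniform exponential clustering on tori) for EVERY compact simple `G` and
EVERY faithful unitary `r` — the infrared half of the Millennium problem on the lattice (Chatterjee
arXiv:1803.01950 Problem 5.1; tree `@[conjecture] LatticeMassGapAllCouplings`), in particular for `SU(2)`
(`su2_clustering_of_not_crux`) — AND (ii) REFUTE `YangMills` as typed (`not_yangMills_of_not_crux`), i.e. refute
the summit conjunct itself (audited 7×, believed true).  Conversely the crux is TRIVIALLY true in a world where the
lattice gap fails for one simple `G` and one faithful `r` (`crux_of_not_latticeClustering`: e.g. a weak-coupling
massless phase à la Patrascioiu–Seiler, or a reducible `r` whose Wilson ray meets no confining regime), and under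
the route's three other items it IS the summit (`crux_iff_yangMills_of_route`, = the gate's `closes`).
So its truth value is `YangMills ∨ ¬LatticeClustering`; no small model, degenerate instance or barrier reaches it.

## Index of findings (all proved)

* §0 ANATOMY: `EC`, `LatticeClustering`, `crux_iff` (definitional read-back), `crux_of_yangMills`,
  `crux_of_not_latticeClustering`, `not_crux_iff`, `not_yangMills_of_not_crux`, `latticeClustering_of_not_crux`,
  `crux_iff_yangMills_of_route`, `su2_isCompactSimpleLieGroup`, `su2Fund`, `su2_clustering_of_not_crux`.
* §1 THE HYPOTHESIS IS NOT JUNK — which of its clauses keep the crux from being vacuous / decorative: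
  - `ecPerVolume_trivial`: with the constant allowed to depend on the volume (`∀ S ∃ C`), clustering holds for
    EVERY `G, r, β` with any rate (a priori bound `2‖A‖∞‖B‖∞ e^{mS} e^{−mn}` for `n ≤ S`): the order `∃ C ∀ S`
    is the entire content of `EC`; the per-volume variant of the crux is ≡ `YangMills` (`cruxPerVolume_iff`).
  - `ec_rate_zero`: with `m = 0` the bound is the a priori bound: `0 < m` is likewise load-bearing for content.
  - `not_allTimes_at`, `not_ecAllTimes`, `not_latticeClusteringAllTimes`: the STRENGTHENED hypothesis with the
    restriction `n ≤ S` removed is FALSE for every non-abelian compact `G`, every faithful `r`, EVERY `β` and every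
    torus (periodicity `τ_{2S+1} = id` + positive variance of the curvature under the fully supported Wilson
    measure — imported from the landed `HypercubicLimit/Negative/AllTimesGapFalse`); hence the all-times variant
    of the crux is VACUOUSLY true (`cruxAllTimes_trivial`).  The thermal clause `n ≤ S` is exactly what makes the
    hypothesis satisfiable; it is not a misstatement (for `n ≤ S` the wrap-around contribution `e^{−m(2S+1−n)}`
    is `≤ e^{−m n}`).
  - `ec_zero_coupling`: at `β = 0` the hypothesis `EC G r 0` HOLDS for every `G, r` (infinite gap: independent Haar
    links, imported `latticeConnectedCorr_zero_coupling`); so `LatticeClustering` restricted to `β₀ ≤ β` with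
    `β₀` EXISTENTIAL cannot be attacked at strong coupling either — Osterwalder–Seiler 1978 give it for all small
    `β`, and the `∃ β₀` absorbs every finite-`β` bulk transition (Bhanot–Creutz endpoints, SU(N ≥ 4) first-order
    points), where volume-uniform clustering genuinely fails (phase coexistence).
* §2 THE CONCLUSION modulo junk: `yangMillsWithoutNontriviality` — `YangMills` with `IsNontrivial ∧ IsNonGaussian`
  deleted is a THEOREM (zero scheme `β ≡ 0` + vacuum OS datum; imported `gap_clauses_junk_reachable`), so the
  variant crux with that conclusion is trivially true and its hypothesis decoration
  (`cruxWithoutNontriviality_trivial`); `yangMills_witness_leaves_zero` — every witness of the conclusion has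
  `β_k ≠ 0` eventually (`not_isNontrivial_of_frequently_beta_zero`, re-derived from the landed `HypercubicLimit/Negative/BetaMustLeaveZero` via `tie_beta_zero_factorises`).  I.e. ALL the work the
  hypothesis could do sits in producing an INTERACTING continuum limit; but `EC` at fixed `β` carries no
  information about `β → ∞` (no rate `m(β) → 0`, no `ξ(β) → ∞`, no control of `C(A,B,β)`), cf. barrier
  `Literature.Barriers.QuantumFields.FixedCouplingUltralocality` and the landed
  `TunedSequenceExists/Negative/UniformClustering` (β-uniform clustering kills every tuned sequence).
* §3 THE ADAPTER (expected stub of the merged dock line): `TorusClusteringH`, `UniformTorusGap`,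
  `StructuredH`, `TorusGapUniformisation`, `rate_sacrifice` (r1-3), `structuredH_iff_uniformTorusGap`,
  `torusClusteringH_of_uniformTorusGap`; abstract shapes `AbsH`, `AbsUTG`, `AbsCover`, the witness
  `witnessF` (travelling bumps at `n ≈ 1/|β − q_j|`, `q_j` enumerating `ℚ`), `continuous_witnessF`,
  `absH_witnessF`, `not_absUTG_witnessF`, `abstract_adapter_false`; `absUTG_of_cover`, `absCover_of_absUTG`.
* §4 BURDEN UPDATE: `dock`, `crux_of_continuumLegGivenGap` (panel, reproduced),
  `not_continuumLegGivenGap_of_not_crux`, `not_dockInputs_of_not_crux`.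
* §5 `-- Targets` = the seven registered stubs of the picked line `spectral-requantisation-dock`
  (vocabulary + `Statement.stub_*` reproduced verbatim in `SRD`): §5a `edgeShiftTime_apply`,
  `siteReflect_siteReflect`, `edgeReflect_edgeReflect`, `disjoint_posEdges_negEdges`,
  `measurable_comp_edgeShiftTime`, `measurable_comp_edgeReflect` (read-back, no junk); §5b
  `TwistVacuaDegenerate`, `MassivePhase`, `stub_gapStability_false_of_twistVacuaDegenerate`,
  `not_twistVacuaDegenerate_of_stub_gapStability`, `not_hasMassGap_of_slowMode` (general: one slow
  positive-time mode excludes a gap), `SlowFluxMode`, `stub_gapStability_false_of_slowFluxMode`,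
  repair `CylGapModSectors` with `cylGapModSectors_one_of_cylGap` (`D = 1` is the old `CylGap`).

## Regimes / attacks tried (cycle 1) — all dead, with the reason

1. Junk in the hypothesis (would make the crux vacuously TRUE, a cheap positive close): `wilsonMeasure` is a
   probability measure for continuous `ρ` (`isProbabilityMeasure_wilsonMeasure`), observables bounded measurable,
   `n ≤ S` present, `∃ β₀` absorbs bulk transitions, `0 < m` per `β`, `C(A,B,β)` per pair: NO junk failure; the
   only failure mode is physical (massless weak-coupling phase for a simple `G`), unprovable today.
2. Junk making the hypothesis trivially TRUE (crux ≡ summit): needs the constant uniform in `S` with `m > 0` —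
   that is the lattice mass gap; per-volume / rate-zero weakenings ARE trivial (§1), the hypothesis as typed is not.
3. Junk in the conclusion making `YangMills` cheaply PROVABLE (crux trivially true): the `⁰𝒮` design leaves
   Schwinger values off `⁰𝒮` unconstrained, but `IsNontrivial` tests time-separated (`0 < x⁰` strict) append
   tensors and `IsNonGaussian` an `IsOffDiagonal` triple tensor whose pair sub-tensors are then automatically
   off-diagonal — contact-term junk cannot satisfy either; ultralocal (`β ≡ 0`, white/Poisson-noise) witnesses
   give c-number data (`not_isNontrivial_beta_zero`, landed by the ContinuumLimitOnTrajectory disprover).  Dead.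
4. Junk making `YangMills` cheaply REFUTABLE (then `¬crux ↔ LatticeClustering`, still open but "only" the IR
   half): `HasLatticeMassGap` has `n ≤ S`, `∀ᶠ k`, per-pair `C`, `S ≥ L_k`; `T.HasMassGap` per-pair constants;
   `IsYangMillsFor` only on off-diagonal product tensors with witness renormalisations (non-scalar channels may be
   renormalised to 0); E0' linear growth plausible for `tr F²`.  No clause is physics-false.  Dead.
5. Degenerate instances: `S = 0` (side-1 torus, `n = 0`: a variance bound) harmless; `r` reducible faithful
   (mixed actions) — covered by `∃ β₀(G, r)`; `G` with `U(1)` factor excluded by `IsSimpleCompactGroup`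
   (non-abelian + no proper closed connected normal subgroup); finite `G` excluded (connected).
6. Barrier catalogue (`Literature/Barriers/QuantumFields/`): FixedCouplingUltralocality, UVStabilityNonUniqueness,
   AbelianDeconfinementD4, FiniteTemperatureDeconfinement — all constrain PROOFS of the crux (the continuum leg),
   none yields `LatticeClustering ∧ ¬YangMills`.
7. Negatives index (`ledger negatives --problem QuantumFields`, 4 entries): none concerns this shape.
8. (cycle 2) The ADAPTER of the merged dock line: not refutable outright (it is implied by expected
   physics: constants locally bounded in β), not provable from H + a priori bound + continuity in β
   (§3b, abstract counterexample), EQUIVALENT to its "structured" rephrasing (§3a) and, abstractly, to a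
   countable uniform cover of the tail (§3c).  Topology/measurability junk in `IsCompactSimpleLieGroup`
   re-checked: `Nonempty (LatticeRep G)` (faithful continuous rep into a Hausdorff group) forces `G`
   Hausdorff, second countable, compact Lie; `IsSimpleCompactGroup` forces simple Lie algebra — no junk `G`.
   8762's criticality hypothesis quantifies over ALL admissible rates with β-dependent constants, so the
   rate sacrifice inside the adapter is harmless for docking (triage r1-1/2/3 confirmed on the typed text).
9. (cycle 3) The seven stubs of the picked line: typed read-back of every definition (`configShift`
   sign, reflection involution, `IsInfiniteVolumeLimitAlong` sides `2S_k+1`, `SlabGauge.weight`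
   unnormalised / `haar` normalised, `lambda0` a genuine `liminf` of a sequence bounded in
   `[e^{-6βnN³}, e^{6βnN³}]`, `gapNorm`/`HasMassGap`, `timeExtent` over the declared support) — no
   junk; `β = 0` instantiation (OS spaces one-dimensional, `ζ ≡ 1`, BD with `K' = 2`) — consistent;
   sector physics — GV false for `π₁(G) ≠ 0` (§5b), T¼ needs `K ≥ |π₁(G)|³ - 1` (free), BD and the
   RQ split untouched.  No unconditional Lean kill of a stub is available: every hypothesis of
   GV/T¼/BD at `β > 0` contains H at `β` (`TorusEC`), certifiable in the tree only at `β = 0`.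

## WHY IT RESISTS (for the provers)

The item is an implication whose consequent is the summit conjunct.  Refuting it = proving the lattice IR mass
gap for all simple `G` and all faithful `r` AND disproving Clay's statement as typed.  Proving it = the entire
UV/continuum programme (ξ(β) → ∞ along some β_k → ∞, Bałaban-type stability with OS E0'/E1, non-triviality and
non-Gaussianity of `tr F²`, transfer of the lattice gap with `k`-uniform constants) with the fixed-β lattice gap
GIVEN — and §2 shows the given hypothesis does not touch any of those steps except the last (where RP spectral
theory self-normalises constants at the true gap rate).  Provers should treat it as a docking item: it closes
only together with a continuum-limit route (cf. grounder g15-10: canonicalise ONE UV leg; EquipartitionCriticality's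
`CriticalContinuumLimit` carries the criticality hypothesis this one silently contains).
-/

noncomputable section

namespace Summit.QuantumFields.YangMills.Cruxes.ClusteringToYangMills.Disproof

open scoped SchwartzMap
open Filter Topology MeasureTheory
open Literature.MathematicalPhysics.AQFT Literature.MathematicalPhysics.QuantumLattice
open Literature.MathematicalPhysics.QuantumFieldTheory
open Summit.QuantumFields.YangMills.Theses
open Summit.QuantumFields.YangMills.Theses.FradkinShenkerFlow
open Summit.QuantumFields.YangMills.Theorems.HypercubicLimit.Negative
open Summit.QuantumFields.YangMills.Theorems.LatticeGapOnTrajectory.Negative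

/-! ## §0 Anatomy: the crux is `LatticeClustering → YangMills` -/

section Anatomy

/-- **`EC G r β`** — volume-uniform exponential clustering in Euclidean time of the torus Wilson measures at
coupling `β` (the route's `EC(β)`, verbatim from the crux). [folklore] -/
def EC (G : Type) [Group G] [TopologicalSpace G] [IsTopologicalGroup G] [CompactSpace G]
    [MeasurableSpace G] [BorelSpace G] (r : LatticeRep G) (β : ℝ) : Prop :=
  ∃ m : ℝ, 0 < m ∧ ∀ A B : YMSpecies G, ∃ C : ℝ, ∀ S n : ℕ, n ≤ S →
    |latticeConnectedCorr r.ρ β (2 * S + 1) A.F B.F n| ≤ C * Real.exp (-(m * n))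

/-- **The hypothesis of the crux**: weak-coupling lattice clustering for every compact simple `G` and every
faithful unitary `r` (the IR half of the lattice mass-gap problem). [folklore] -/
def LatticeClustering : Prop :=
  ∀ (G : Type) [Group G] [TopologicalSpace G] [IsTopologicalGroup G] [CompactSpace G]
    [MeasurableSpace G] [BorelSpace G], IsCompactSimpleLieGroup G →
      ∀ r : LatticeRep G, ∃ β₀ : ℝ, ∀ β : ℝ, β₀ ≤ β → EC G r β

/-- Read-back (definitional): the crux is `LatticeClustering → YangMills`. [folklore] -/
theorem crux_iff : ClusteringToYangMills ↔ (LatticeClustering → YangMills) := Iff.rfl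

/-- The crux follows from the summit conjunct (it is at most as hard as `YangMills`). [folklore] -/
theorem crux_of_yangMills (h : YangMills) : ClusteringToYangMills := fun _ => h

/-- The crux holds VACUOUSLY if the lattice gap fails for some simple `G` and faithful `r`. [folklore] -/
theorem crux_of_not_latticeClustering (h : ¬ LatticeClustering) : ClusteringToYangMills :=
  fun hc => (h hc).elim

/-- **Disproof burden.** `¬ crux ↔ LatticeClustering ∧ ¬ YangMills`. [folklore] -/
theorem not_crux_iff : ¬ ClusteringToYangMills ↔ (LatticeClustering ∧ ¬ YangMills) := by
  rw [crux_iff, Classical.not_imp]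

/-- Any refutation of the crux refutes the typed Clay statement `YangMills`. [folklore] -/
theorem not_yangMills_of_not_crux (h : ¬ ClusteringToYangMills) : ¬ YangMills := (not_crux_iff.1 h).2

/-- Any refutation of the crux proves the weak-coupling lattice mass gap for every simple `G`, faithful `r`.
[folklore] -/
theorem latticeClustering_of_not_crux (h : ¬ ClusteringToYangMills) : LatticeClustering := (not_crux_iff.1 h).1

/-- The truth value of the crux is `YangMills ∨ ¬ LatticeClustering`. [folklore] -/
theorem crux_iff_or : ClusteringToYangMills ↔ (YangMills ∨ ¬ LatticeClustering) := by
  rw [crux_iff]; tauto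

/-- **Under the route's three other items the crux IS the summit** (forward direction = the gate's `closes`).
[folklore] -/
theorem crux_iff_yangMills_of_route (hSP : SusceptibilityToPoincare) (hPC : PoincareToClustering)
    (hFS : FiniteSusceptibilityWeakCoupling) : ClusteringToYangMills ↔ YangMills :=
  ⟨fun h => closes hSP hPC hFS h, crux_of_yangMills⟩

/-- `SU(2)` is a certified compact simple Lie group (tree: `isSimpleCompactGroup_specialUnitaryGroup_holds`).
[folklore] -/
theorem su2_isCompactSimpleLieGroup : IsCompactSimpleLieGroup (Matrix.specialUnitaryGroup (Fin 2) ℂ) :=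
  isCompactSimpleLieGroup_specialUnitaryGroup isSimpleCompactGroup_specialUnitaryGroup_holds le_rfl

/-- The fundamental lattice representation of `SU(2)` (Wilson's original model). [folklore] -/
def su2Fund : LatticeRep (Matrix.specialUnitaryGroup (Fin 2) ℂ) :=
  ⟨2, fundamentalRep (Fin 2), continuous_fundamentalRep _, fundamentalRep_injective _,
    fundamentalRep_mem_unitaryGroup⟩

/-- **Concrete burden**: a refutation of the crux would in particular prove volume-uniform exponential
clustering of `SU(2)` lattice gauge theory with Wilson's fundamental action at all large `β` — open since
Wilson 1974. [folklore] -/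
theorem su2_clustering_of_not_crux (h : ¬ ClusteringToYangMills) :
    ∃ β₀ : ℝ, ∀ β : ℝ, β₀ ≤ β → EC (Matrix.specialUnitaryGroup (Fin 2) ℂ) su2Fund β :=
  latticeClustering_of_not_crux h _ su2_isCompactSimpleLieGroup su2Fund

end Anatomy

/-! ## §1 The hypothesis is not junk: per-volume / rate-zero weakenings are trivial, the all-times
strengthening is false, `β = 0` satisfies it -/

section Hypothesis

variable {G : Type} [Group G] [TopologicalSpace G] [IsTopologicalGroup G] [CompactSpace G]
  [MeasurableSpace G] [BorelSpace G]

variable (G) in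
/-- `EC` with the constant allowed to depend on the volume (`∀ S ∃ C` instead of `∃ C ∀ S`). [folklore] -/
def ECPerVolume (r : LatticeRep G) (β : ℝ) : Prop :=
  ∃ m : ℝ, 0 < m ∧ ∀ A B : YMSpecies G, ∀ S : ℕ, ∃ C : ℝ, ∀ n : ℕ, n ≤ S →
    |latticeConnectedCorr r.ρ β (2 * S + 1) A.F B.F n| ≤ C * Real.exp (-(m * n))

/-- **Per-volume clustering is contentless**: it holds for every `G, r, β` (with any rate, here `m = 1`) by the a
priori bound `|corr| ≤ 2‖A‖∞‖B‖∞` and `e^{S} e^{-n} ≥ 1` for `n ≤ S`.  The quantifier order `∃ C ∀ S` carries the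
entire content of the hypothesis. [folklore] -/
theorem ecPerVolume_trivial (r : LatticeRep G) (β : ℝ) : ECPerVolume G r β := by
  refine ⟨1, one_pos, fun A B S => ?_⟩
  obtain ⟨CA, hCA⟩ := A.bounded
  obtain ⟨CB, hCB⟩ := B.bounded
  refine ⟨2 * (CA * CB) * Real.exp (1 * S), fun n hn => ?_⟩
  have h := abs_latticeConnectedCorr_le r β (2 * S + 1) hCA hCB n
  have hCAB : 0 ≤ 2 * (CA * CB) := le_trans (abs_nonneg _) h
  have hexp : 1 ≤ Real.exp (1 * S) * Real.exp (-(1 * n)) := by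
    rw [← Real.exp_add, Real.one_le_exp_iff]
    have : (n : ℝ) ≤ S := by exact_mod_cast hn
    linarith
  calc |latticeConnectedCorr r.ρ β (2 * S + 1) A.F B.F n| ≤ 2 * (CA * CB) * 1 := by rw [mul_one]; exact h
    _ ≤ 2 * (CA * CB) * (Real.exp (1 * S) * Real.exp (-(1 * n))) := mul_le_mul_of_nonneg_left hexp hCAB
    _ = 2 * (CA * CB) * Real.exp (1 * S) * Real.exp (-(1 * n)) := by ring

/-- The per-volume variant of the hypothesis, for all simple `G` and faithful `r`. [folklore] -/
def LatticeClusteringPerVolume : Prop :=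
  ∀ (G : Type) [Group G] [TopologicalSpace G] [IsTopologicalGroup G] [CompactSpace G]
    [MeasurableSpace G] [BorelSpace G], IsCompactSimpleLieGroup G →
      ∀ r : LatticeRep G, ∃ β₀ : ℝ, ∀ β : ℝ, β₀ ≤ β → ECPerVolume G r β

omit [Group G] [TopologicalSpace G] [IsTopologicalGroup G] [CompactSpace G] [MeasurableSpace G]
  [BorelSpace G] in
/-- … is a theorem, [folklore] -/
theorem latticeClusteringPerVolume : LatticeClusteringPerVolume :=
  fun _ _ _ _ _ _ _ _ r => ⟨0, fun β _ => ecPerVolume_trivial r β⟩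

omit [Group G] [TopologicalSpace G] [IsTopologicalGroup G] [CompactSpace G] [MeasurableSpace G]
  [BorelSpace G] in
/-- … so the crux with the per-volume hypothesis is literally the summit: `S`-uniformity of `C` is
load-bearing for the hypothesis to say anything. [folklore] -/
theorem cruxPerVolume_iff : (LatticeClusteringPerVolume → YangMills) ↔ YangMills :=
  ⟨fun h => h latticeClusteringPerVolume, fun h _ => h⟩

/-- **Rate zero is contentless too**: with `m = 0` the clustering bound is the a priori bound. [folklore] -/
theorem ec_rate_zero (r : LatticeRep G) (β : ℝ) (A B : YMSpecies G) :
    ∃ C : ℝ, ∀ S n : ℕ, n ≤ S →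
      |latticeConnectedCorr r.ρ β (2 * S + 1) A.F B.F n| ≤ C * Real.exp (-(0 * n)) := by
  obtain ⟨CA, hCA⟩ := A.bounded
  obtain ⟨CB, hCB⟩ := B.bounded
  exact ⟨2 * (CA * CB), fun S n _ => by
    simpa using abs_latticeConnectedCorr_le r β (2 * S + 1) hCA hCB n⟩

variable (G) in
/-- `EC` with the thermal restriction `n ≤ S` REMOVED (all time separations on each torus). [folklore] -/
def ECAllTimes (r : LatticeRep G) (β : ℝ) : Prop :=
  ∃ m : ℝ, 0 < m ∧ ∀ A B : YMSpecies G, ∃ C : ℝ, ∀ S n : ℕ,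
    |latticeConnectedCorr r.ρ β (2 * S + 1) A.F B.F n| ≤ C * Real.exp (-(m * n))

/-- **No torus admits an all-times exponential bound for the curvature autocorrelation** (non-abelian `G`,
faithful `r`, any `β`, any rate `m > 0`, any side `2S+1`): by periodicity `corr(k(2S+1)) = corr(0)` is the
variance of the action density, which is positive under the fully supported Wilson measure, while the bound
tends to `0` along `k → ∞`. [folklore] -/
theorem not_allTimes_at (hG : ∃ a b : G, a * b ≠ b * a) (r : LatticeRep G) (β : ℝ) {m : ℝ} (hm : 0 < m)
    (S : ℕ) :
    ¬ ∃ C : ℝ, ∀ n : ℕ, |latticeConnectedCorr r.ρ β (2 * S + 1) r.curvature.F r.curvature.F n| ≤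
      C * Real.exp (-(m * n)) := by
  rintro ⟨C, hC⟩
  obtain ⟨a, b, hab⟩ := hG
  have hbound : ∀ k : ℕ, |latticeConnectedCorr r.ρ β (2 * S + 1) r.curvature.F r.curvature.F 0| ≤
      C * Real.exp (-(m * ((0 + k * (2 * S + 1) : ℕ) : ℝ))) := fun k => by
    rw [← latticeConnectedCorr_add_mul_side r.ρ β (2 * S + 1) r.curvature.F r.curvature.F 0 k]
    exact hC _
  have hlim : Tendsto (fun k : ℕ => C * Real.exp (-(m * ((0 + k * (2 * S + 1) : ℕ) : ℝ)))) atTop (𝓝 0) := by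
    have h1 : Tendsto (fun k : ℕ => m * ((0 + k * (2 * S + 1) : ℕ) : ℝ)) atTop atTop := by
      have : (fun k : ℕ => m * ((0 + k * (2 * S + 1) : ℕ) : ℝ)) =
          fun k : ℕ => (m * ((2 * S + 1 : ℕ) : ℝ)) * (k : ℝ) := by
        funext k; push_cast; ring
      rw [this]
      exact Tendsto.const_mul_atTop (mul_pos hm (by positivity)) tendsto_natCast_atTop_atTop
    have h2 := Real.tendsto_exp_atBot.comp (tendsto_neg_atTop_atBot.comp h1)
    simpa using h2.const_mul C
  have h0 : |latticeConnectedCorr r.ρ β (2 * S + 1) r.curvature.F r.curvature.F 0| ≤ 0 :=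
    ge_of_tendsto' hlim hbound
  have hz : latticeConnectedCorr r.ρ β (2 * S + 1) r.curvature.F r.curvature.F 0 = 0 :=
    abs_eq_zero.1 (le_antisymm h0 (abs_nonneg _))
  rw [latticeConnectedCorr_zero_time] at hz
  have hP : Continuous fun W : GaugeConfig 4 (2 * S + 1) G => r.curvature.F (torusLift (2 * S + 1) W) :=
    (continuous_actionDensity r.continuous).comp (continuous_pi fun _ => continuous_apply _)
  have hne : r.curvature.F (torusLift (2 * S + 1)
      (fun e : Edge 4 (2 * S + 1) => if e.2 = 0 then a else if e.2 = 1 then b else (1 : G))) ≠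
      r.curvature.F (torusLift (2 * S + 1) (fun _ => 1)) := by
    rw [torusLift_dirConfigT, torusLift_one]
    exact actionDensity_ne r hab
  have hvar := variance_pos r β (2 * S + 1) hP hne
  linarith

/-- **The all-times strengthening of `EC` is false** for every non-abelian compact `G`, faithful `r`, every `β`.
[folklore] -/
theorem not_ecAllTimes (hG : ∃ a b : G, a * b ≠ b * a) (r : LatticeRep G) (β : ℝ) : ¬ ECAllTimes G r β := by
  rintro ⟨m, hm, h⟩
  obtain ⟨C, hC⟩ := h r.curvature r.curvature
  exact not_allTimes_at hG r β hm 0 ⟨C, fun n => hC 0 n⟩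

/-- The all-times variant of the hypothesis. [folklore] -/
def LatticeClusteringAllTimes : Prop :=
  ∀ (G : Type) [Group G] [TopologicalSpace G] [IsTopologicalGroup G] [CompactSpace G]
    [MeasurableSpace G] [BorelSpace G], IsCompactSimpleLieGroup G →
      ∀ r : LatticeRep G, ∃ β₀ : ℝ, ∀ β : ℝ, β₀ ≤ β → ECAllTimes G r β

omit [Group G] [TopologicalSpace G] [IsTopologicalGroup G] [CompactSpace G] [MeasurableSpace G]
  [BorelSpace G] in
/-- **… is FALSE** (instantiate at `SU(2)`, fundamental `r`, `β = β₀`). [folklore] -/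
theorem not_latticeClusteringAllTimes : ¬ LatticeClusteringAllTimes := fun h => by
  obtain ⟨β₀, hβ₀⟩ := h (Matrix.specialUnitaryGroup (Fin 2) ℂ) su2_isCompactSimpleLieGroup su2Fund
  exact not_ecAllTimes su2_isCompactSimpleLieGroup.1.2.1 su2Fund β₀ (hβ₀ β₀ le_rfl)

omit [Group G] [TopologicalSpace G] [IsTopologicalGroup G] [CompactSpace G] [MeasurableSpace G]
  [BorelSpace G] in
/-- **… so the all-times variant of the crux is VACUOUSLY true**: the thermal clause `n ≤ S` in the hypothesis
is load-bearing for NON-VACUITY of the item (without it the item would close `proved` for the wrong reason).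
[folklore] -/
theorem cruxAllTimes_trivial : LatticeClusteringAllTimes → YangMills :=
  fun h => (not_latticeClusteringAllTimes h).elim

/-- **Zero coupling satisfies the hypothesis** (infinite gap): at `β = 0` the links are independent Haar
variables, so the connected correlation of `A` and `τ_n B` vanishes exactly once the torus projections of the
supports are disjoint (`2R < n`, `n + 2R < 2S+1`, `R` = time extent of the supports), and is a priori bounded
otherwise; hence `EC G r 0` with `m = 1`, `C = 2‖A‖‖B‖ e^{2R+... }`.  So the `∃ β₀` / weak-coupling placement of
the hypothesis is not where an attack can start: clustering is KNOWN at `β = 0` (here) and for small `β`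
(Osterwalder–Seiler 1978), believed at large `β`, and fails only at bulk transition points, which `∃ β₀(G,r)`
skips. [folklore] -/
theorem ec_zero_coupling (r : LatticeRep G) : EC G r 0 := by
  refine ⟨1, one_pos, fun A B => ?_⟩
  obtain ⟨CA, hCA⟩ := A.bounded
  obtain ⟨CB, hCB⟩ := B.bounded
  -- time extent of the two supports
  set R : ℕ := (A.supp ∪ B.supp).sup fun e => (e.1 0).natAbs with hR
  have hRA : ∀ e ∈ A.supp, |e.1 0| ≤ R := fun e he => by
    have : (e.1 0).natAbs ≤ R := Finset.le_sup (f := fun e => (e.1 0).natAbs) (Finset.mem_union_left _ he)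
    rw [Int.abs_eq_natAbs]; exact_mod_cast this
  have hRB : ∀ e ∈ B.supp, |e.1 0| ≤ R := fun e he => by
    have : (e.1 0).natAbs ≤ R := Finset.le_sup (f := fun e => (e.1 0).natAbs) (Finset.mem_union_right _ he)
    rw [Int.abs_eq_natAbs]; exact_mod_cast this
  have hCAB : 0 ≤ 2 * (CA * CB) :=
    le_trans (abs_nonneg _) (abs_latticeConnectedCorr_le r 0 (2 * 0 + 1) hCA hCB 0)
  refine ⟨2 * (CA * CB) * Real.exp (1 * (4 * R + 1)), fun S n hn => ?_⟩
  by_cases hfar : 2 * R < n ∧ n + 2 * R < 2 * S + 1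
  · -- disjoint torus supports: the connected correlation vanishes
    have hdisj := disjoint_torusSupports_of_time_bound A.supp B.supp R hRA hRB hfar.1 hfar.2
    rw [latticeConnectedCorr_zero_coupling r.ρ (2 * S + 1) A B n hdisj, abs_zero]
    positivity
  · -- near regime: n ≤ 2R or 2S+1 ≤ n + 2R (with n ≤ S this forces n ≤ 4R): a priori bound
    have hn4 : (n : ℝ) ≤ 4 * R + 1 := by
      have : n ≤ 4 * R + 1 := by omega
      exact_mod_cast this
    have h := abs_latticeConnectedCorr_le r 0 (2 * S + 1) hCA hCB n
    have hexp : 1 ≤ Real.exp (1 * (4 * R + 1)) * Real.exp (-(1 * n)) := by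
      rw [← Real.exp_add, Real.one_le_exp_iff]; linarith
    calc |latticeConnectedCorr r.ρ 0 (2 * S + 1) A.F B.F n| ≤ 2 * (CA * CB) * 1 := by rw [mul_one]; exact h
      _ ≤ 2 * (CA * CB) * (Real.exp (1 * (4 * R + 1)) * Real.exp (-(1 * n))) :=
          mul_le_mul_of_nonneg_left hexp hCAB
      _ = 2 * (CA * CB) * Real.exp (1 * (4 * R + 1)) * Real.exp (-(1 * n)) := by ring

end Hypothesis

/-! ## §2 The conclusion modulo junk: only the interacting continuum limit is at stake -/

section Conclusion

/-- `YangMills` with the clauses `IsNontrivial ∧ IsNonGaussian` deleted. [folklore] -/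
def YangMillsWithoutNontriviality : Prop :=
  ∀ (G : Type) [Group G] [TopologicalSpace G] [IsTopologicalGroup G] [CompactSpace G],
    IsCompactSimpleLieGroup G →
      letI : MeasurableSpace G := borel G
      haveI : BorelSpace G := ⟨rfl⟩
      ∃ (r : LatticeRep G) (sch : SpeciesScheme (YMSpecies G)) (T : OSData (YMSpecies G) 4),
        IsYangMillsFor r sch T ∧ ∃ Δ > 0, T.HasMassGap Δ ∧ HasLatticeMassGap r sch Δ

/-- **… is a THEOREM** (zero scheme `β ≡ 0`, `c = m = 0`, vacuum OS datum; any `Δ`): everything in the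
conclusion except non-triviality/non-Gaussianity of `tr F²` is junk-reachable. [folklore] -/
theorem yangMillsWithoutNontriviality : YangMillsWithoutNontriviality := by
  intro G _ _ _ _ hG
  letI : MeasurableSpace G := borel G
  haveI : BorelSpace G := ⟨rfl⟩
  obtain ⟨r⟩ := hG.2
  obtain ⟨sch, T, hYM, hgap⟩ := gap_clauses_junk_reachable r
  exact ⟨r, sch, T, hYM, 1, one_pos, hgap 1⟩

/-- … hence the crux with that weakened conclusion is trivially true, its hypothesis pure decoration: whatever
`LatticeClustering` can contribute to a proof of the crux, it contributes to the INTERACTING continuum limit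
(`IsNontrivial ∧ IsNonGaussian` jointly with `IsYangMillsFor` and the gap), nowhere else. [folklore] -/
theorem cruxWithoutNontriviality_trivial : LatticeClustering → YangMillsWithoutNontriviality :=
  fun _ => yangMillsWithoutNontriviality

/-- `tensor₁ w` is the tensor of the constant string `w` (copy of the HypercubicLimit disprover's
`isTensorOf_tensor₁_const`, whose module `BetaMustLeaveZero` is not yet built on the farm). [folklore] -/
theorem isTensorOf_tensor₁_const' (w : 𝓢((EuclideanSpace ℝ (Fin 4)), ℝ)) :
    IsTensorOf (tensor₁ w) (fun _ => ofRealTest w) := by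
  intro x
  rw [isTensorOf_tensor₁ w x]
  simp

/-- **`β_k = 0` frequently ⇒ no witness**: if the scheme returns to zero coupling infinitely often, every OS
datum tied to it by `IsYangMillsFor` is TRIVIAL in `tr F²` (the curvature two-point function factorises on real
off-diagonal tensors, `tie_beta_zero_factorises`, and the real→complex bridge
`not_twoPointNontrivial_of_factorizes`; re-derived from the landed `HypercubicLimit/Negative/BetaMustLeaveZero`).
[folklore] -/
theorem not_isNontrivial_of_frequently_beta_zero {G : Type} [Group G] [TopologicalSpace G]
    [IsTopologicalGroup G] [CompactSpace G] [MeasurableSpace G] [BorelSpace G]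
    (r : LatticeRep G) (sch : SpeciesScheme (YMSpecies G)) (T : OSData (YMSpecies G) 4)
    (hβ : ∃ᶠ k in atTop, sch.β k = 0) (hT : IsYangMillsFor r sch T) : ¬ T.IsNontrivial r.curvature := by
  have hconv : ∀ (n : ℕ), n ≠ 0 → ∀ (f : Fin n → 𝓢(EuclideanSpace ℝ (Fin 4), ℝ))
      (F : 𝓢((Fin n → EuclideanSpace ℝ (Fin 4)), ℂ)), IsTensorOf F (fun i => ofRealTest (f i)) →
      IsOffDiagonal F → Tendsto (fun k : ℕ => ((latticeSchwinger r.ρ sch (fun s => s.F) k n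
        (fun _ => r.curvature) f : ℝ) : ℂ)) atTop (𝓝 (T.schwinger n (fun _ => r.curvature) F)) :=
    fun n hn f F hF hF' => hT n hn (fun _ => r.curvature) f F hF hF'
  refine not_twoPointNontrivial_of_factorizes T.schwinger r.curvature fun u v hu hv => ?_
  have hod : IsOffDiagonal (tensor₂ u v) := isOffDiagonal_of_halfSpaces hu hv (isTensorOf_tensor₂ u v)
  have h := Summit.QuantumFields.YangMills.Theorems.CurvatureBoostCovariance.Negative.tie_beta_zero_factorises
    r sch hβ
    (S₁ := fun n => T.schwinger n (fun _ => r.curvature)) hconv (n := 1 + 1) (by norm_num)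
    ![u, v] (tensor₂ u v) (isTensorOf_tensor₂ u v) hod ![tensor₁ u, tensor₁ v]
    (fun i => by fin_cases i <;> simpa using isTensorOf_tensor₁_const' _)
  rw [h, Fin.prod_univ_two]
  rfl

/-- **Every witness of the conclusion leaves `β = 0`**: in any proof of `YangMills`, for every simple `G` the
witnessing scheme has `β_k ≠ 0` for all large `k` (at `β_k = 0` frequently the curvature two-point function
factorises, contradicting `IsNontrivial`).  The hypothesis `LatticeClustering` speaks about fixed `β ≥ β₀`
only; the bridge `β_k → ∞` with `a_k m(β_k) → Δ` (criticality, `ξ(β) → ∞`) is entirely inside the crux.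
[folklore] -/
theorem yangMills_witness_leaves_zero (h : YangMills) (G : Type) [Group G] [TopologicalSpace G]
    [IsTopologicalGroup G] [CompactSpace G] (hG : IsCompactSimpleLieGroup G) :
    letI : MeasurableSpace G := borel G
    haveI : BorelSpace G := ⟨rfl⟩
    ∃ (r : LatticeRep G) (sch : SpeciesScheme (YMSpecies G)) (T : OSData (YMSpecies G) 4),
      IsYangMillsFor r sch T ∧ T.IsNontrivial r.curvature ∧ ∀ᶠ k in atTop, sch.β k ≠ 0 := by
  letI : MeasurableSpace G := borel G
  haveI : BorelSpace G := ⟨rfl⟩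
  obtain ⟨r, sch, T, hYM, hnt, -, -⟩ := h G hG
  refine ⟨r, sch, T, hYM, hnt, ?_⟩
  by_contra hne
  rw [Filter.not_eventually] at hne
  exact not_isNontrivial_of_frequently_beta_zero r sch T (hne.mono fun k hk => not_not.1 hk) hYM hnt

/-- Combined with the crux: under `LatticeClustering`, the crux delivers for `SU(2)` a Wilson scheme leaving
`β = 0` with an interacting OS limit — the statement a prover actually has to establish. [folklore] -/
theorem crux_delivers_su2 (h : ClusteringToYangMills) (hLC : LatticeClustering) :
    ∃ (r : LatticeRep (Matrix.specialUnitaryGroup (Fin 2) ℂ))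
      (sch : SpeciesScheme (YMSpecies (Matrix.specialUnitaryGroup (Fin 2) ℂ)))
      (T : OSData (YMSpecies (Matrix.specialUnitaryGroup (Fin 2) ℂ)) 4),
      IsYangMillsFor r sch T ∧ T.IsNontrivial r.curvature ∧ ∀ᶠ k in atTop, sch.β k ≠ 0 :=
  yangMills_witness_leaves_zero (h hLC) _ su2_isCompactSimpleLieGroup

end Conclusion

/-! ## §3 The dock line's adapter — the expected stub — under attack (cycle 2)

The triage panel (TRIAGE-r1-1/2/3) merged the three dock cards into ONE line,
`adapter → XiDiverges (8941) → CriticalityOfXiDiverges (12318) → CriticalContinuumLimit (8762) → crux`,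
whose only own stub is the ADAPTER `H ⇒ UniformTorusGap` per `(G, r)` (`TorusGapUniformisation` ≡
`UniformiseConstants` ⊇ `TorusConstantsUpgrade`).  No line is picked yet (`targets = []`); this
section attacks the adapter pre-emptively.  Findings (all checked):
* §3a `structuredH_iff_uniformTorusGap`: triage r1-3's "weakened" target `StructuredH` is
  EQUIVALENT to `UniformTorusGap` — structuring the constants per β is a rephrasing, not a
  weakening; and `UniformTorusGap → TorusClusteringH` (sandwich), so the stub is `H ⇒ UTG` exactly.
* §3b `abstract_adapter_false`: the adapter is NOT SOFT over real `β`: an explicit family of pair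
  correlations, a priori bounded and CONTINUOUS in `β` at each fixed (pair, volume, time), satisfies
  the H-shape at EVERY `β` and violates the UTG-shape for every tail / rate function / thresholds
  (Baire category: couplings approximated by the blow-up points `q_j` faster than `1 / log C_j`).
  So any proof of the stub must use a β-REGULARITY of the volume-uniform constants that H does not
  state and continuity of finite-volume Wilson expectations does not supply.
* §3c `absUTG_of_cover` / `absCover_of_absUTG`: abstractly the UTG-shape is EQUIVALENT to a countable
  UNIFORM cover of the tail (pieces with a common rate and per-pair constants) — the exact residual:
  e.g. local boundedness on compact coupling intervals (triage r1-2 (S*)), free along any SEQUENCE of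
  couplings (triage r1-2 `sequential_uniformise`), free from any structured supplier (r1-3), and in
  Clay-as-typed it is demanded only along the witness sequence (`HasLatticeMassGap`: `∀ A B ∃ C ∀ᶠ k`).
  Recommendation stands (all three triagers): type the hub's torus clause along `β_k → ∞`, or have
  H's supplier (`PoincareToClustering`, Martinelli-type proof) export structured constants.
-/

section Adapter


/-- **Rate sacrifice** (elementary; statement and proof from triage r1-3's
`TriageAdapterBookkeeping3.rate_sacrifice`, reproduced so that this file is self-contained): an
a-priori bound `|c| ≤ a` and a clustering bound with multiplicative excess `exp (Γ K)` combine into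
the `Γ`-free constant `a · w · exp K` at the slower rate `μ / max 1 Γ`. [folklore] -/
theorem rate_sacrifice {a w K Γ μ x c : ℝ} (ha : 1 ≤ a) (hw : 1 ≤ w) (hK : 0 ≤ K)
    (h1 : |c| ≤ a) (h2 : |c| ≤ w * Real.exp (Γ * K) * Real.exp (-(μ * x))) :
    |c| ≤ a * w * Real.exp K * Real.exp (-(μ / max 1 Γ * x)) := by
  set L := max 1 Γ with hL
  have hL1 : 1 ≤ L := le_max_left _ _
  have hLΓ : Γ ≤ L := le_max_right _ _
  have hL0 : 0 < L := lt_of_lt_of_le one_pos hL1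
  have ha0 : 0 ≤ a := le_trans zero_le_one ha
  have haw : 1 ≤ a * w := by nlinarith
  by_cases h : μ * x ≤ L * K
  · have hle : μ / L * x ≤ K := by
      rw [div_mul_eq_mul_div, div_le_iff₀ hL0]; linarith [mul_comm L K]
    have hone : 1 ≤ Real.exp K * Real.exp (-(μ / L * x)) := by
      rw [← Real.exp_add]; exact Real.one_le_exp (by linarith)
    calc |c| ≤ a := h1
      _ ≤ a * w := by nlinarith
      _ = a * w * 1 := (mul_one _).symm
      _ ≤ a * w * (Real.exp K * Real.exp (-(μ / L * x))) := by
          exact mul_le_mul_of_nonneg_left hone (by linarith)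
      _ = a * w * Real.exp K * Real.exp (-(μ / L * x)) := by ring
  · push Not at h
    have h3 : K < μ * x / L := by rw [lt_div_iff₀ hL0]; linarith
    have h4 : K * (L - 1) ≤ μ * x / L * (L - 1) :=
      mul_le_mul_of_nonneg_right h3.le (by linarith)
    have h5 : K * Γ ≤ K * L := mul_le_mul_of_nonneg_left hLΓ hK
    have h7 : μ * x / L * (L - 1) = μ * x - μ * x / L := by
      field_simp
    have h6 : μ / L * x = μ * x / L := by ring
    have key : Γ * K + -(μ * x) ≤ K + -(μ / L * x) := by
      rw [h6]; rw [h7] at h4; nlinarith [h4, h5]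
    calc |c| ≤ w * Real.exp (Γ * K) * Real.exp (-(μ * x)) := h2
      _ = w * Real.exp (Γ * K + -(μ * x)) := by rw [Real.exp_add]; ring
      _ ≤ w * Real.exp (K + -(μ / L * x)) :=
          mul_le_mul_of_nonneg_left (Real.exp_le_exp.2 key) (by linarith)
      _ = 1 * w * (Real.exp K * Real.exp (-(μ / L * x))) := by rw [Real.exp_add]; ring
      _ ≤ a * w * (Real.exp K * Real.exp (-(μ / L * x))) := by
          apply mul_le_mul_of_nonneg_right _ (by positivity)
          exact mul_le_mul_of_nonneg_right ha (by linarith)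
      _ = a * w * Real.exp K * Real.exp (-(μ / L * x)) := by ring

variable {G : Type} [Group G] [TopologicalSpace G] [IsTopologicalGroup G] [CompactSpace G]
  [MeasurableSpace G] [BorelSpace G]

variable (G) in
/-- H of the crux for ONE `(G, r)` (verbatim antecedent of `ClusteringToYangMills`; = the panel's
`TorusClusteringH`). [folklore] -/
def TorusClusteringH (r : LatticeRep G) : Prop :=
  ∃ β₀ : ℝ, ∀ β : ℝ, β₀ ≤ β → (∃ m : ℝ, 0 < m ∧ ∀ A B : YMSpecies G, ∃ C : ℝ, ∀ S n : ℕ, n ≤ S →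
    |latticeConnectedCorr r.ρ β (2 * S + 1) A.F B.F n| ≤ C * Real.exp (-(m * n)))

variable (G) in
/-- The β-UNIFORM large-torus shape (= body of `EquipartitionCriticality.LatticeGapLargeBeta` for
one `(G, r)` = hypothesis 1 of `CriticalContinuumLimit`; = the panel's `UniformTorusGap`). [folklore] -/
def UniformTorusGap (r : LatticeRep G) : Prop :=
  ∃ (β₁ : ℝ) (m : ℝ → ℝ) (S₀ : ℝ → ℕ), (∀ β : ℝ, β₁ ≤ β → 0 < m β) ∧
    ∀ A B : YMSpecies G, ∃ C : ℝ, ∀ β : ℝ, β₁ ≤ β → ∀ S n : ℕ, S₀ β ≤ S → n ≤ S →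
      |latticeConnectedCorr r.ρ β (2 * S + 1) A.F B.F n| ≤ C * Real.exp (-(m β * n))

variable (G) in
/-- Triage r1-3's **structured H** (per β: SOME rate `μ_β`, SOME `Γ_β`; β-free size functional
`κ ≥ 0` and prefactor `w ≥ 1`), proposed there as a WEAKENED adapter target. [folklore] -/
def StructuredH (r : LatticeRep G) : Prop :=
  ∃ κ : YMSpecies G → ℝ, (∀ A, 0 ≤ κ A) ∧ ∃ w : YMSpecies G → YMSpecies G → ℝ, (∀ A B, 1 ≤ w A B) ∧
    ∃ β₀ : ℝ, ∀ β : ℝ, β₀ ≤ β → ∃ μ Γ : ℝ, 0 < μ ∧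
      ∀ A B : YMSpecies G, ∀ S n : ℕ, n ≤ S →
        |latticeConnectedCorr r.ρ β (2 * S + 1) A.F B.F n| ≤
          w A B * Real.exp (Γ * (κ A + κ B)) * Real.exp (-(μ * n))

/-- The dock cards' adapter (`TorusGapUniformisation` of card spectral-requantisation-dock ≡
`UniformiseConstants` of card dock-continuum-leg): per `(G, r)`, H ⇒ the β-uniform shape. [folklore] -/
def TorusGapUniformisation : Prop :=
  ∀ (G : Type) [Group G] [TopologicalSpace G] [IsTopologicalGroup G] [CompactSpace G]
    [MeasurableSpace G] [BorelSpace G], IsCompactSimpleLieGroup G → ∀ r : LatticeRep G,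
    TorusClusteringH G r → UniformTorusGap G r

/-- A bound for the observable `A` (choice from `A.bounded`). [folklore] -/
def obsBound (A : YMSpecies G) : ℝ := Classical.choose A.bounded

omit [TopologicalSpace G] [IsTopologicalGroup G] [CompactSpace G] [BorelSpace G] in
theorem abs_le_obsBound (A : YMSpecies G) (U : LGConfig 4 G) : |A.F U| ≤ obsBound A :=
  Classical.choose_spec A.bounded U

/-- Structured H ⇒ the β-uniform shape, by rate sacrifice alone (triage r1-3,
`uniformTorusGap_of_structuredH`, reproduced). [folklore] -/
theorem uniformTorusGap_of_structuredH (r : LatticeRep G) (h : StructuredH G r) :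
    UniformTorusGap G r := by
  obtain ⟨κ, hκ, w, hw, β₀, hβ⟩ := h
  choose μ Γ hμ hb using hβ
  refine ⟨β₀, fun β => if h : β₀ ≤ β then μ β h / max 1 (Γ β h) else 1, fun _ => 0, ?_, ?_⟩
  · intro β hβ0
    simp only [hβ0, ↓reduceDIte]
    exact div_pos (hμ β hβ0) (lt_of_lt_of_le one_pos (le_max_left _ _))
  · intro A B
    refine ⟨max 1 (2 * (obsBound A * obsBound B)) * w A B * Real.exp (κ A + κ B),
      fun β hβ0 S n _ hn => ?_⟩
    have h1 : |latticeConnectedCorr r.ρ β (2 * S + 1) A.F B.F n| ≤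
        max 1 (2 * (obsBound A * obsBound B)) :=
      (abs_latticeConnectedCorr_le r β (2 * S + 1) (abs_le_obsBound A) (abs_le_obsBound B) n).trans
        (le_max_right _ _)
    have h2 := hb β hβ0 A B S n hn
    have := rate_sacrifice (le_max_left _ _) (hw A B) (add_nonneg (hκ A) (hκ B)) h1 h2
    simpa only [hβ0, ↓reduceDIte] using this

/-- **Conversely, the β-uniform shape ⇒ structured H** (`κ ≡ 1`, `w := max 1 (max C 2‖A‖‖B‖)`,
`μ := m β`, `Γ := m β · S₀ β / 2` absorbs the sub-threshold volumes). [folklore] -/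
theorem structuredH_of_uniformTorusGap (r : LatticeRep G) (h : UniformTorusGap G r) :
    StructuredH G r := by
  obtain ⟨β₁, m, S₀, hm, hC⟩ := h
  choose C hC using hC
  refine ⟨fun _ => 1, fun _ => zero_le_one,
    fun A B => max 1 (max (C A B) (2 * (obsBound A * obsBound B))), fun A B => le_max_left _ _,
    β₁, fun β hβ => ⟨m β, m β * S₀ β / 2, hm β hβ, fun A B S n hn => ?_⟩⟩
  have hmβ := hm β hβ
  set w := max 1 (max (C A B) (2 * (obsBound A * obsBound B))) with hw
  have hw0 : 0 ≤ w := le_trans zero_le_one (le_max_left _ _)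
  have hΓ : m β * S₀ β / 2 * ((1 : ℝ) + 1) = m β * S₀ β := by ring
  rw [hΓ]
  by_cases hS : S₀ β ≤ S
  · have h1 := hC A B β hβ S n hS hn
    have hCw : C A B ≤ w := le_trans (le_max_left _ _) (le_max_right _ _)
    have hexp1 : 1 ≤ Real.exp (m β * S₀ β) := Real.one_le_exp (by positivity)
    calc |latticeConnectedCorr r.ρ β (2 * S + 1) A.F B.F n| ≤ C A B * Real.exp (-(m β * n)) := h1
      _ ≤ w * Real.exp (-(m β * n)) := mul_le_mul_of_nonneg_right hCw (Real.exp_pos _).le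
      _ = w * 1 * Real.exp (-(m β * n)) := by rw [mul_one]
      _ ≤ w * Real.exp (m β * S₀ β) * Real.exp (-(m β * n)) := by
          apply mul_le_mul_of_nonneg_right _ (Real.exp_pos _).le
          exact mul_le_mul_of_nonneg_left hexp1 hw0
  · push Not at hS
    have hnS : (n : ℝ) ≤ S₀ β := by exact_mod_cast (le_of_lt (lt_of_le_of_lt hn hS))
    have h1 : |latticeConnectedCorr r.ρ β (2 * S + 1) A.F B.F n| ≤ w :=
      (abs_latticeConnectedCorr_le r β (2 * S + 1) (abs_le_obsBound A) (abs_le_obsBound B) n).trans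
        (le_trans (le_max_right _ _) (le_max_right _ _))
    have hexp : 1 ≤ Real.exp (m β * S₀ β) * Real.exp (-(m β * n)) := by
      rw [← Real.exp_add]; refine Real.one_le_exp ?_
      nlinarith [hmβ.le, hnS]
    calc |latticeConnectedCorr r.ρ β (2 * S + 1) A.F B.F n| ≤ w * 1 := by rw [mul_one]; exact h1
      _ ≤ w * (Real.exp (m β * S₀ β) * Real.exp (-(m β * n))) := mul_le_mul_of_nonneg_left hexp hw0
      _ = w * Real.exp (m β * S₀ β) * Real.exp (-(m β * n)) := by ring

/-- **"Structuring H per β" is NOT a weakening of the adapter's target: it is EQUIVALENT to it.**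
So the merged dock line's only own stub is exactly `H ⇒ UniformTorusGap` per `(G, r)`, however it
is phrased; its content is β-regularity of the volume-uniform constants (§3b). [folklore] -/
theorem structuredH_iff_uniformTorusGap (r : LatticeRep G) : StructuredH G r ↔ UniformTorusGap G r :=
  ⟨uniformTorusGap_of_structuredH r, structuredH_of_uniformTorusGap r⟩

/-- The β-uniform shape implies H on its tail (sub-threshold volumes by the a priori bound), so the
adapter's target is sandwiched: `UniformTorusGap G r → TorusClusteringH G r`. [folklore] -/
theorem torusClusteringH_of_uniformTorusGap (r : LatticeRep G) (h : UniformTorusGap G r) :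
    TorusClusteringH G r := by
  obtain ⟨κ, -, w, -, β₀, hβ⟩ := structuredH_of_uniformTorusGap r h
  refine ⟨β₀, fun β hβ0 => ?_⟩
  obtain ⟨μ, Γ, hμ, hb⟩ := hβ β hβ0
  exact ⟨μ, hμ, fun A B => ⟨w A B * Real.exp (Γ * (κ A + κ B)), fun S n hn => hb A B S n hn⟩⟩


end Adapter

/-! ### §3b Abstract non-softness of the real-β adapter (Baire category) -/

section Abstract

open Set Metric


/-! ### Abstract shapes: a family of "pair correlations" `f j β S n` indexed by pairs `j : ℕ`,
coupling `β : ℝ`, torus half-side `S` and time separation `n`. -/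

/-- Abstract shape of the crux hypothesis H for one `(G, r)` (here even for EVERY `β`, no `β₀`):
per-`β` rate, per-pair constants, uniform in the volume. [folklore] -/
def AbsH (f : ℕ → ℝ → ℕ → ℕ → ℝ) : Prop :=
  ∀ β : ℝ, ∃ m : ℝ, 0 < m ∧ ∀ j : ℕ, ∃ C : ℝ, ∀ S n : ℕ, n ≤ S →
    |f j β S n| ≤ C * Real.exp (-(m * n))

/-- Abstract shape of the adapter's target (`UniformTorusGap` = body of `LatticeGapLargeBeta` =
hypothesis 1 of `CriticalContinuumLimit`): β-free per-pair constants on a tail, one rate function,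
volume thresholds. [folklore] -/
def AbsUTG (f : ℕ → ℝ → ℕ → ℕ → ℝ) : Prop :=
  ∃ (β₁ : ℝ) (m : ℝ → ℝ) (S₀ : ℝ → ℕ), (∀ β : ℝ, β₁ ≤ β → 0 < m β) ∧
    ∀ j : ℕ, ∃ C : ℝ, ∀ β : ℝ, β₁ ≤ β → ∀ S n : ℕ, S₀ β ≤ S → n ≤ S →
      |f j β S n| ≤ C * Real.exp (-(m β * n))

/-- An enumeration of the rationals, as reals. [folklore] -/
def ratSeq (j : ℕ) : ℝ := (((Denumerable.eqv ℚ).symm j : ℚ) : ℝ)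

theorem denseRange_ratSeq : DenseRange ratSeq := by
  have h : Set.range ratSeq = Set.range ((↑) : ℚ → ℝ) := by
    show Set.range (((↑) : ℚ → ℝ) ∘ (Denumerable.eqv ℚ).symm) = _
    exact (Denumerable.eqv ℚ).symm.surjective.range_comp _
  show Dense (Set.range ratSeq)
  rw [h]
  exact Rat.denseRange_cast

/-- The travelling bump: height `2` on `|n - N| ≤ 1`, zero on `|n - N| ≥ 2`. [folklore] -/
def bump (N : ℝ) (n : ℕ) : ℝ := 2 * max 0 (min 1 (2 - |(n : ℝ) - N|))

theorem bump_nonneg (N : ℝ) (n : ℕ) : 0 ≤ bump N n :=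
  mul_nonneg zero_le_two (le_max_left _ _)

theorem bump_le_two (N : ℝ) (n : ℕ) : bump N n ≤ 2 := by
  have : max 0 (min 1 (2 - |(n : ℝ) - N|)) ≤ 1 := max_le zero_le_one (min_le_left _ _)
  unfold bump; linarith

theorem bump_eq_zero_of_le {N : ℝ} {n : ℕ} (h : (n : ℝ) + 2 ≤ N) : bump N n = 0 := by
  unfold bump
  have habs : |(n : ℝ) - N| = N - n := by
    rw [abs_sub_comm]; exact abs_of_nonneg (by linarith)
  rw [habs, max_eq_left (le_trans (min_le_right _ _) (by linarith)), mul_zero]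

theorem bump_eq_two_of_abs_lt {N : ℝ} {n : ℕ} (h : |(n : ℝ) - N| < 1) : bump N n = 2 := by
  unfold bump
  rw [min_eq_left (by linarith), max_eq_right zero_le_one, mul_one]

theorem bump_eq_zero_of_ge {N : ℝ} {n : ℕ} (h : N + 2 ≤ (n : ℝ)) : bump N n = 0 := by
  unfold bump
  have habs : |(n : ℝ) - N| = n - N := abs_of_nonneg (by linarith)
  rw [habs, max_eq_left (le_trans (min_le_right _ _) (by linarith)), mul_zero]

theorem lt_of_bump_ne_zero {N : ℝ} {n : ℕ} (h : bump N n ≠ 0) : (n : ℝ) < N + 2 := by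
  by_contra hle
  exact h (bump_eq_zero_of_ge (by linarith))

/-- **The witness family.** Pair `j` has, at coupling `β ≠ q_j`, a bump of height `2` at time
separation `n ≈ 1/|β - q_j|`, and vanishes at `β = q_j`; `(q_j)` enumerates `ℚ`. [folklore] -/
def witnessF (j : ℕ) (β : ℝ) (_S n : ℕ) : ℝ :=
  if β = ratSeq j then 0 else bump (1 / |β - ratSeq j|) n

theorem abs_witnessF_le (j : ℕ) (β : ℝ) (S n : ℕ) : |witnessF j β S n| ≤ 2 := by
  unfold witnessF
  split_ifs
  · simp
  · rw [abs_of_nonneg (bump_nonneg _ _)]; exact bump_le_two _ _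

theorem witnessF_nonneg (j : ℕ) (β : ℝ) (S n : ℕ) : 0 ≤ witnessF j β S n := by
  unfold witnessF
  split_ifs
  · exact le_rfl
  · exact bump_nonneg _ _

/-- Near `q_j` (and at `q_j`) the witness vanishes identically at each fixed time `n`. [folklore] -/
theorem witnessF_eq_zero_of_near (j : ℕ) {β : ℝ} (S n : ℕ)
    (h : |β - ratSeq j| < 1 / ((n : ℝ) + 2)) : witnessF j β S n = 0 := by
  unfold witnessF
  split_ifs with hβ
  · rfl
  · have hpos : 0 < |β - ratSeq j| := abs_pos.2 (sub_ne_zero.2 hβ)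
    apply bump_eq_zero_of_le
    rw [le_div_iff₀ hpos]
    have hn2 : (0 : ℝ) < n + 2 := by positivity
    have := (lt_div_iff₀ hn2).1 h
    linarith

/-- **Continuity in the coupling** of every single value of the witness family. [folklore] -/
theorem continuous_witnessF (j S n : ℕ) : Continuous fun β => witnessF j β S n := by
  refine continuous_iff_continuousAt.2 fun β₀ => ?_
  by_cases hβ : β₀ = ratSeq j
  · -- locally identically zero around `q_j`
    have hev : (fun β => witnessF j β S n) =ᶠ[𝓝 β₀] fun _ => 0 := by
      have hr : (0 : ℝ) < 1 / ((n : ℝ) + 2) := by positivity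
      filter_upwards [Metric.ball_mem_nhds β₀ hr] with β hβ'
      refine witnessF_eq_zero_of_near j S n ?_
      rw [hβ.symm]
      simpa [Real.dist_eq] using hβ'
    exact (continuousAt_const.congr hev.symm)
  · -- away from `q_j` the formula is a composition of continuous maps
    have hev : (fun β => witnessF j β S n) =ᶠ[𝓝 β₀] fun β => bump (1 / |β - ratSeq j|) n := by
      filter_upwards [isOpen_ne.mem_nhds hβ] with β hβ'
      simp [witnessF, hβ']
    refine ContinuousAt.congr ?_ hev.symm
    have hne : |β₀ - ratSeq j| ≠ 0 := abs_ne_zero.2 (sub_ne_zero.2 hβ)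
    have h1 : ContinuousAt (fun β : ℝ => 1 / |β - ratSeq j|) β₀ :=
      continuousAt_const.div ((continuous_id.sub continuous_const).abs.continuousAt) hne
    unfold bump
    refine continuousAt_const.mul (continuousAt_const.max (continuousAt_const.min ?_))
    exact continuousAt_const.sub ((continuousAt_const.sub h1).abs)

/-- **Per-β clustering holds** for the witness family, at every `β`, rate `1`, constants
`2 e^{1/|β - q_j| + 2}`, uniformly in the volume. [folklore] -/
theorem absH_witnessF : AbsH witnessF := by
  intro β
  refine ⟨1, one_pos, fun j => ⟨2 * Real.exp (1 / |β - ratSeq j| + 2), fun S n _ => ?_⟩⟩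
  rw [abs_of_nonneg (witnessF_nonneg _ _ _ _)]
  by_cases h0 : witnessF j β S n = 0
  · rw [h0]; positivity
  · have hval : witnessF j β S n = bump (1 / |β - ratSeq j|) n := by
      unfold witnessF at h0 ⊢; split_ifs with hβ
      · exact (h0 (by simp [hβ])).elim
      · rfl
    rw [hval] at h0 ⊢
    have hn : (n : ℝ) < 1 / |β - ratSeq j| + 2 := lt_of_bump_ne_zero h0
    have hexp : 1 ≤ Real.exp (1 / |β - ratSeq j| + 2) * Real.exp (-(1 * n)) := by
      rw [← Real.exp_add]; exact Real.one_le_exp (by linarith)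
    calc bump (1 / |β - ratSeq j|) n ≤ 2 * 1 := by rw [mul_one]; exact bump_le_two _ _
      _ ≤ 2 * (Real.exp (1 / |β - ratSeq j| + 2) * Real.exp (-(1 * n))) :=
          mul_le_mul_of_nonneg_left hexp zero_le_two
      _ = 2 * Real.exp (1 / |β - ratSeq j| + 2) * Real.exp (-(1 * n)) := by ring

/-- **… but the β-uniform shape FAILS** for the witness family: for any tail, rate function and
β-free constants `C_j`, Baire's theorem gives a coupling `β` in the tail, different from every
`q_j`, approximated by rationals `q_j` faster than `1/log C_j`; at such `β` the bump of pair `j`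
sits at `n ≈ 1/|β - q_j| ≫ log C_j / m(β)`. [folklore] -/
theorem not_absUTG_witnessF : ¬ AbsUTG witnessF := by
  rintro ⟨β₁, m, S₀, hm, hC⟩
  choose C hC using hC
  -- Baire: a point of the tail in every `U k` and off every `q_j`
  set L : ℕ → ℝ := fun j => max 1 (Real.log (C j)) with hL
  have hL1 : ∀ j, 1 ≤ L j := fun j => le_max_left _ _
  have hL0 : ∀ j, 0 < L j := fun j => lt_of_lt_of_le one_pos (hL1 j)
  set r : ℕ → ℕ → ℝ := fun j k => 1 / ((k + 2 : ℝ) * L j) with hr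
  have hr0 : ∀ j k, 0 < r j k := fun j k => by
    simp only [hr]; exact div_pos one_pos (mul_pos (by positivity) (hL0 j))
  set U : ℕ → Set ℝ := fun k => ⋃ j, ball (ratSeq j) (r j k) with hU
  set V : ℕ → Set ℝ := fun j => {ratSeq j}ᶜ with hV
  set W : ℕ ⊕ ℕ → Set ℝ := Sum.elim U V with hW
  have hWo : ∀ i, IsOpen (W i) := by
    rintro (k | j)
    · simp only [hW, Sum.elim_inl, hU]; exact isOpen_iUnion fun j => isOpen_ball
    · simp only [hW, Sum.elim_inr, hV]; exact isOpen_compl_singleton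
  have hWd : ∀ i, Dense (W i) := by
    rintro (k | j)
    · simp only [hW, Sum.elim_inl, hU]
      refine denseRange_ratSeq.mono ?_
      rintro _ ⟨j, rfl⟩
      exact Set.mem_iUnion.2 ⟨j, mem_ball_self (hr0 j k)⟩
    · simp only [hW, Sum.elim_inr, hV]; exact dense_compl_singleton _
  have hD : Dense (⋂ i, W i) := dense_iInter_of_isOpen hWo hWd
  obtain ⟨β, hβ1, hβW⟩ := hD.inter_open_nonempty (Ioi β₁) isOpen_Ioi ⟨β₁ + 1, by simp⟩
  rw [Set.mem_iInter] at hβW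
  have hβU : ∀ k, β ∈ U k := fun k => hβW (Sum.inl k)
  have hβV : ∀ j, β ≠ ratSeq j := fun j => hβW (Sum.inr j)
  have hβ1' : β₁ ≤ β := le_of_lt hβ1
  -- the rate at β and the scale k
  have hmβ := hm β hβ1'
  obtain ⟨k, hk⟩ := exists_nat_gt (4 / m β)
  have hk2 : 4 / m β < (k : ℝ) + 2 := by linarith
  have hk2' : 4 < m β * ((k : ℝ) + 2) := by
    rwa [div_lt_iff₀' hmβ] at hk2
  -- the pair j whose rational is very close to β
  obtain ⟨j, hj⟩ : ∃ j, β ∈ ball (ratSeq j) (r j k) := by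
    simpa [hU] using hβU k
  rw [mem_ball, Real.dist_eq] at hj
  have hδ : 0 < |β - ratSeq j| := abs_pos.2 (sub_ne_zero.2 (hβV j))
  set N : ℝ := 1 / |β - ratSeq j| with hN
  have hN0 : 0 ≤ N := le_of_lt (div_pos one_pos hδ)
  have hNbig : ((k : ℝ) + 2) * L j < N := by
    rw [hN, lt_div_iff₀ hδ]
    have := (lt_div_iff₀ (mul_pos (by positivity : (0:ℝ) < k + 2) (hL0 j))).1 hj
    linarith [this]
  -- the time n = ⌈N⌉ where the bump has full height
  set n : ℕ := ⌈N⌉₊ with hn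
  have hnN : N ≤ n := Nat.le_ceil N
  have hnN' : (n : ℝ) < N + 1 := Nat.ceil_lt_add_one hN0
  have hval : witnessF j β (max (S₀ β) n) n = 2 := by
    unfold witnessF
    rw [if_neg (hβV j)]
    exact bump_eq_two_of_abs_lt (by rw [abs_lt]; constructor <;> linarith)
  -- the uniform bound at (j, β, S = max (S₀ β) n, n)
  have hb := hC j β hβ1' (max (S₀ β) n) n (le_max_left _ _) (le_max_right _ _)
  rw [hval, abs_of_pos two_pos] at hb
  -- hence C j ≥ 2 and m β · n ≤ log (C j) ≤ L j
  have hexp_le : Real.exp (-(m β * n)) ≤ 1 := by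
    rw [Real.exp_le_one_iff]; nlinarith [hN0, hnN, hmβ.le]
  have hCpos : 0 < C j := by
    by_contra hle; push Not at hle
    nlinarith [Real.exp_pos (-(m β * n))]
  have hC2 : (2 : ℝ) ≤ C j := by nlinarith [Real.exp_pos (-(m β * n))]
  have hlog : m β * n ≤ Real.log (C j) := by
    have h2 : Real.exp (m β * n) * 2 ≤ C j := by
      have := mul_le_mul_of_nonneg_left hb (Real.exp_pos (m β * n)).le
      rwa [← mul_assoc, mul_comm (Real.exp _) (C j), mul_assoc, ← Real.exp_add,
        add_neg_cancel, Real.exp_zero, mul_one] at this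
    have h3 : Real.exp (m β * n) ≤ C j := by linarith [Real.exp_pos (m β * n)]
    exact (Real.le_log_iff_exp_le hCpos).2 h3
  have hlogL : Real.log (C j) ≤ L j := le_max_right _ _
  -- contradiction: m β · N ≤ L j but N > (k+2) L j and m β (k+2) > 4
  have h1 : m β * N ≤ L j := le_trans (by nlinarith [hmβ.le]) (hlog.trans hlogL)
  have h2 : m β * (((k : ℝ) + 2) * L j) < m β * N := mul_lt_mul_of_pos_left hNbig hmβ
  nlinarith [hL0 j, h1, h2, hk2']

/-- **ABSTRACT NON-SOFTNESS OF THE REAL-β ADAPTER.** There is a family of "pair correlations",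
a priori bounded by `2` and CONTINUOUS in the coupling at every fixed `(pair, volume, time)`,
which clusters exponentially at EVERY coupling with volume-uniform per-pair constants (the shape
of H), yet admits NO β-free constants on any tail for any rate function and any volume thresholds
(the shape of `UniformTorusGap` / `LatticeGapLargeBeta` / hypothesis 1 of `CriticalContinuumLimit`).
Hence the dock line's adapter `H ⇒ UniformTorusGap` cannot be proved from H, the a priori bound
and continuity in `β` of the torus correlations alone: some LOCAL BOUNDEDNESS IN β of the
volume-uniform constants (a countable uniform cover of the tail, see `absUTG_of_cover`) must come
from the supplier of H.  NEAR-MISS / open sharpening (not constructed here): the witness is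
unstructured in `(S, n)`; a witness with the reflection-positive TORUS TRACE FORM
`Tr(T_{β,V}^{2S+1-n} Ã T_{β,V}^{n} B̃)/Tr T_{β,V}^{2S+1}` (positive transfer matrices whose thermal
multiplicities are tuned in `β`, cf. triage r1-2's falsifier (b) "flat-band / residual-entropy RP
models") would show that even RP + spectral structure does not make the adapter soft; in INFINITE
volume RP self-normalises the constants (`‖ÂΩ‖‖B̂Ω‖` at the true gap), so the whole residual is the
finite-torus thermal contamination, uniformly in β. [folklore] -/
theorem abstract_adapter_false :
    ∃ f : ℕ → ℝ → ℕ → ℕ → ℝ, (∀ j β S n, |f j β S n| ≤ 2) ∧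
      (∀ j S n, Continuous fun β => f j β S n) ∧ AbsH f ∧ ¬ AbsUTG f :=
  ⟨witnessF, abs_witnessF_le, continuous_witnessF, absH_witnessF, not_absUTG_witnessF⟩


/-! ### §3c Exact sufficient regularity: a countable uniform cover of the tail (diagonal lemma) -/

/-- A countable UNIFORM cover of a tail: pieces `X k` on each of which the H-shape bound holds
uniformly in `β` (common rate `μ_k`, per-pair constants; any structure within a piece). [folklore] -/
def AbsCover (f : ℕ → ℝ → ℕ → ℕ → ℝ) : Prop :=
  ∃ (β₁ : ℝ) (X : ℕ → Set ℝ), (∀ β : ℝ, β₁ ≤ β → ∃ k, β ∈ X k) ∧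
    ∀ k : ℕ, ∃ μ : ℝ, 0 < μ ∧ ∀ j : ℕ, ∃ C : ℝ, ∀ β ∈ X k, ∀ S n : ℕ, n ≤ S →
      |f j β S n| ≤ C * Real.exp (-(μ * n))

/-- **Exact sufficient regularity (diagonal lemma + rate sacrifice).** If the tail is a COUNTABLE
union of pieces on each of which H holds uniformly in `β`, then the β-uniform shape follows, with
`S₀ ≡ 0`, constants `max 1 a_j · e^{b_j}` and rate `μ_k / ν_k` on piece `k`, where
`Φ k j := log⁺ C_{k,j} ≤ ν_k · b_j` is the diagonal domination `b_j := 1 + Σ_{k ≤ j} Φ k j`,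
`ν_k := 1 + Σ_{j < k} Φ k j`.  With §3b: for families continuous in `β` the adapter is EXACTLY the
existence of such a cover (e.g. local boundedness of the volume-uniform constants on compact
coupling intervals; for the Wilson family the pairs reduce to countably many support boxes by
Banach–Steinhaus, cards dock-continuum-leg S3a / triage r1-2 (S*)). [folklore] -/
theorem absUTG_of_cover {f : ℕ → ℝ → ℕ → ℕ → ℝ} {a : ℕ → ℝ} (ha : ∀ j β S n, |f j β S n| ≤ a j)
    (h : AbsCover f) : AbsUTG f := by
  obtain ⟨β₁, X, hcov, hunif⟩ := h
  choose μ hμ C hC using hunif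
  choose kk hkk using hcov
  -- log-constants, made ≥ 0
  set Φ : ℕ → ℕ → ℝ := fun k j => Real.log (max 1 (C k j)) with hΦ
  have hΦ0 : ∀ k j, 0 ≤ Φ k j := fun k j => Real.log_nonneg (le_max_left _ _)
  have hCΦ : ∀ k j, C k j ≤ Real.exp (Φ k j) := fun k j => by
    simp only [hΦ]
    rw [Real.exp_log (lt_of_lt_of_le one_pos (le_max_left _ _))]
    exact le_max_right _ _
  -- diagonal domination Φ k j ≤ ν k * b j
  set b : ℕ → ℝ := fun j => 1 + ∑ k ∈ Finset.range (j + 1), Φ k j with hb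
  set ν : ℕ → ℝ := fun k => 1 + ∑ j ∈ Finset.range k, Φ k j with hν
  have hb1 : ∀ j, 1 ≤ b j := fun j => by
    have := Finset.sum_nonneg (s := Finset.range (j + 1)) (fun k _ => hΦ0 k j)
    simp only [hb]; linarith
  have hν1 : ∀ k, 1 ≤ ν k := fun k => by
    have := Finset.sum_nonneg (s := Finset.range k) (fun j _ => hΦ0 k j)
    simp only [hν]; linarith
  have hdom : ∀ k j, Φ k j ≤ ν k * b j := by
    intro k j
    rcases le_or_gt k j with hkj | hjk
    · have h1 : Φ k j ≤ ∑ k' ∈ Finset.range (j + 1), Φ k' j :=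
        Finset.single_le_sum (f := fun k' => Φ k' j) (fun k' _ => hΦ0 k' j)
          (Finset.mem_range.2 (Nat.lt_succ_of_le hkj))
      have h2 : Φ k j ≤ b j := by simp only [hb]; linarith
      calc Φ k j ≤ b j := h2
        _ = 1 * b j := (one_mul _).symm
        _ ≤ ν k * b j := mul_le_mul_of_nonneg_right (hν1 k) (le_trans zero_le_one (hb1 j))
    · have h1 : Φ k j ≤ ∑ j' ∈ Finset.range k, Φ k j' :=
        Finset.single_le_sum (f := fun j' => Φ k j') (fun j' _ => hΦ0 k j') (Finset.mem_range.2 hjk)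
      have h2 : Φ k j ≤ ν k := by simp only [hν]; linarith
      calc Φ k j ≤ ν k := h2
        _ = ν k * 1 := (mul_one _).symm
        _ ≤ ν k * b j := mul_le_mul_of_nonneg_left (hb1 j) (le_trans zero_le_one (hν1 k))
  refine ⟨β₁, fun β => if h : β₁ ≤ β then μ (kk β h) / max 1 (ν (kk β h)) else 1, fun _ => 0,
    ?_, ?_⟩
  · intro β hβ
    simp only [hβ, ↓reduceDIte]
    exact div_pos (hμ _) (lt_of_lt_of_le one_pos (le_max_left _ _))
  · intro j
    refine ⟨max 1 (a j) * 1 * Real.exp (b j), fun β hβ S n _ hn => ?_⟩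
    have hβk : β ∈ X (kk β hβ) := hkk β hβ
    have h1 : |f j β S n| ≤ max 1 (a j) := (ha j β S n).trans (le_max_right _ _)
    have h2 : |f j β S n| ≤ 1 * Real.exp (ν (kk β hβ) * b j) * Real.exp (-(μ (kk β hβ) * n)) := by
      rw [one_mul]
      calc |f j β S n| ≤ C (kk β hβ) j * Real.exp (-(μ (kk β hβ) * n)) := hC _ j β hβk S n hn
        _ ≤ Real.exp (Φ (kk β hβ) j) * Real.exp (-(μ (kk β hβ) * n)) :=
            mul_le_mul_of_nonneg_right (hCΦ _ j) (Real.exp_pos _).le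
        _ ≤ Real.exp (ν (kk β hβ) * b j) * Real.exp (-(μ (kk β hβ) * n)) :=
            mul_le_mul_of_nonneg_right (Real.exp_le_exp.2 (hdom _ j)) (Real.exp_pos _).le
    have := rate_sacrifice (le_max_left _ _) le_rfl (le_trans zero_le_one (hb1 j)) h1 h2
    simpa only [hβ, ↓reduceDIte] using this

/-- The converse bookkeeping: the β-uniform shape yields a countable uniform cover (pieces =
level sets of the rate and the threshold). So, abstractly, `AbsUTG f ↔ AbsCover f` for a priori
bounded families. [folklore] -/
theorem absCover_of_absUTG {f : ℕ → ℝ → ℕ → ℕ → ℝ} {a : ℕ → ℝ} (ha : ∀ j β S n, |f j β S n| ≤ a j)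
    (h : AbsUTG f) : AbsCover f := by
  obtain ⟨β₁, m, S₀, hm, hC⟩ := h
  choose C hC using hC
  refine ⟨β₁, fun k => {β | β₁ ≤ β ∧ 1 / (k + 1 : ℝ) ≤ m β ∧ S₀ β ≤ k}, fun β hβ => ?_, fun k => ?_⟩
  · obtain ⟨k₁, hk₁⟩ := exists_nat_gt (1 / m β)
    refine ⟨max k₁ (S₀ β), hβ, ?_, le_max_right _ _⟩
    have hmβ := hm β hβ
    rw [div_le_iff₀ (by positivity)]
    have : 1 / m β < (max k₁ (S₀ β) : ℕ) + 1 := by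
      have : (k₁ : ℝ) ≤ (max k₁ (S₀ β) : ℕ) := by exact_mod_cast le_max_left _ _
      linarith
    have h2 := (div_lt_iff₀ hmβ).1 this
    linarith
  · refine ⟨1 / (k + 1 : ℝ), by positivity, fun j => ⟨max (C j) (max 0 (a j) * Real.exp k), ?_⟩⟩
    rintro β ⟨hβ, hmk, hSk⟩ S n hn
    by_cases hS : S₀ β ≤ S
    · calc |f j β S n| ≤ C j * Real.exp (-(m β * n)) := hC j β hβ S n hS hn
        _ ≤ max (C j) (max 0 (a j) * Real.exp k) * Real.exp (-(m β * n)) := by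
            exact mul_le_mul_of_nonneg_right (le_max_left _ _) (Real.exp_pos _).le
        _ ≤ max (C j) (max 0 (a j) * Real.exp k) * Real.exp (-(1 / (k + 1 : ℝ) * n)) := by
            apply mul_le_mul_of_nonneg_left _ (le_trans (le_trans (le_max_left _ _)
              (le_trans (le_mul_of_one_le_right (le_max_left _ _) (Real.one_le_exp (by positivity)))
                le_rfl)) (le_max_right _ _))
            exact Real.exp_le_exp.2 (by nlinarith [Nat.cast_nonneg (α := ℝ) n])
    · push Not at hS
      have hnk : (n : ℝ) ≤ k := by exact_mod_cast (le_trans hn (le_trans hS.le hSk))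
      have hexp : 1 ≤ Real.exp k * Real.exp (-(1 / (k + 1 : ℝ) * n)) := by
        rw [← Real.exp_add]; refine Real.one_le_exp ?_
        have hk0 : (0 : ℝ) < k + 1 := by positivity
        have : 1 / (k + 1 : ℝ) * n ≤ n := by
          rw [div_mul_eq_mul_div, one_mul, div_le_iff₀ hk0]; nlinarith [Nat.cast_nonneg (α := ℝ) n]
        linarith
      calc |f j β S n| ≤ max 0 (a j) := (ha j β S n).trans (le_max_right _ _)
        _ = max 0 (a j) * 1 := (mul_one _).symm
        _ ≤ max 0 (a j) * (Real.exp k * Real.exp (-(1 / (k + 1 : ℝ) * n))) :=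
            mul_le_mul_of_nonneg_left hexp (le_max_left _ _)
        _ = max 0 (a j) * Real.exp k * Real.exp (-(1 / (k + 1 : ℝ) * n)) := by ring
        _ ≤ max (C j) (max 0 (a j) * Real.exp k) * Real.exp (-(1 / (k + 1 : ℝ) * n)) :=
            mul_le_mul_of_nonneg_right (le_max_right _ _) (Real.exp_pos _).le

end Abstract

/-! ## §4 Burden update through the panel's certified docks (cycle 2)

`¬ crux` now provably entails, besides `LatticeClustering ∧ ¬ YangMills` (§0): `¬ ContinuumLegGivenGap`
(stmt-8782, by the checked dominance 8782 ⇒ 9443) and `¬ (adapter ∧ 8941 ∧ 12318 ∧ 8762)` (by the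
checked dock).  Read positively: the crux is implied by 8782 alone and by the dock inputs; a
disprover of 9443 is simultaneously a disprover of the whole UV hub. -/

section Burden


/-- The panel's certified dock (card spectral-requantisation-dock, `Sketch-ideator1.dock`,
reproduced): adapter + `XiDiverges` + `CriticalityOfXiDiverges` + `CriticalContinuumLimit` ⊢ crux.
[folklore] -/
theorem dock (hU : TorusGapUniformisation) (hXi : DirichletWindow.XiDiverges)
    (hCrit : DirichletWindow.CriticalityOfXiDiverges)
    (hCCL : EquipartitionCriticality.CriticalContinuumLimit) : ClusteringToYangMills := by
  intro hH G _ _ _ _ hG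
  letI : MeasurableSpace G := borel G
  haveI : BorelSpace G := ⟨rfl⟩
  have h1 : ∀ r : LatticeRep G, UniformTorusGap G r := fun r => hU G hG r (hH G hG r)
  exact hCCL G hG h1 (hCrit hXi G hG)

/-- The panel's certified dominance (card antipodal-docking, `SketchDominanceIdeator2.crux_of_8782`,
reproduced): `ContinuumLegGivenGap` (stmt-8782) ⊢ crux, by `S₁ := 0`. [folklore] -/
theorem crux_of_continuumLegGivenGap (h : ConvexGribovBody.ContinuumLegGivenGap) :
    ClusteringToYangMills := by
  intro hEC G _ _ _ _ hG
  letI : MeasurableSpace G := borel G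
  haveI : BorelSpace G := ⟨rfl⟩
  refine h G hG (fun r => ?_)
  obtain ⟨β₀, hβ₀⟩ := hEC G hG r
  refine ⟨β₀, fun β hβ => ?_⟩
  obtain ⟨m, hm, hAB⟩ := hβ₀ β hβ
  exact ⟨m, hm, 0, fun A B => (hAB A B).imp fun C hC S n _ hn => hC S n hn⟩

/-- **Burden update 1.** A refutation of the crux refutes the shared existence leg
`ContinuumLegGivenGap` (stmt-QuantumFields-8782, routes ConvexGribovBody / SmallCircleAnchor). [folklore] -/
theorem not_continuumLegGivenGap_of_not_crux (h : ¬ ClusteringToYangMills) :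
    ¬ ConvexGribovBody.ContinuumLegGivenGap := fun h' => h (crux_of_continuumLegGivenGap h')

/-- **Burden update 2.** A refutation of the crux refutes one of: the adapter, `XiDiverges`
(stmt-8941), `CriticalityOfXiDiverges` (stmt-12318), `CriticalContinuumLimit` (stmt-8762). [folklore] -/
theorem not_dockInputs_of_not_crux (h : ¬ ClusteringToYangMills) :
    ¬ (TorusGapUniformisation ∧ DirichletWindow.XiDiverges ∧ DirichletWindow.CriticalityOfXiDiverges ∧
      EquipartitionCriticality.CriticalContinuumLimit) :=
  fun ⟨hU, hXi, hCrit, hCCL⟩ => h (dock hU hXi hCrit hCCL)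


end Burden

/-! ## §5 Targets — the picked line `spectral-requantisation-dock` (gen 3, cycle 3)

The lead PICKED `spectral-requantisation-dock` (PICKED.md, 2026-08-16T02:41Z) and registered the
skeleton `Lines/spectral-requantisation-dock.lean` (sha 35e55645…) with SEVEN stubs:
`stub_cylinderApprox` (RQ0), `stub_reconstructible` (RQa), `stub_osDensity` (RQb1),
`stub_gapFromClustering` (RQb2) — the lead's split of RQ —, `stub_gapStability` (GV),
`stub_thermalMultiplicity` (T¼), `stub_blockDecomposition` (BD).  The skeleton module is not
built on the farm (no `.olean` under `Cruxes/`), so its vocabulary and the `Statement.stub_*`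
Props are reproduced VERBATIM (same bodies, docstrings tagged) in the sub-namespace `SRD`: every
`SRD.Statement.stub_X` is definitionally the registered stub.

Verdicts of this cycle (details in §5a/§5b and the module docblock):
* RQ0, RQa, RQb1, RQb2 — TRUE in substance (measure theory on the compact metrisable
  `G^{edges}`; bond AND site reflection positivity of Wilson's action passed to odd-torus limit
  states; `ι F = ι (P F)` gauge averaging on site-disjoint halves; Glimm–Jaffe 6.1.3 in dense
  form).  Read-back of every definition: no junk (§5a proves the `μ`-free OS premises for the
  line's `(Θ, τ, 𝓔₊)`: shift sign, involution, half-space exchange).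
* GV — FALSE for every simple `G` with `π₁(G) ≠ 0` at weak coupling ('t Hooft twist sectors),
  conditionally on the standard physics isolated as `TwistVacuaDegenerate ∧ MassivePhase`
  (§5b, `stub_gapStability_false_of_twistVacuaDegenerate`, checked).  Plausible for simply
  connected `G`.  Repair: `CylGapModSectors` (§5b).
* T¼ — survives as typed only because `K(G, r)` is free: `ζ_β(N/4, N³) → |π₁(G)|³` forces
  `K ≥ |π₁(G)|³ - 1`; vacuous wherever its CylGap hypothesis fails.
* BD — consistent at `β = 0` (`K' = 2`), a transfer-matrix identity elsewhere; vacuously true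
  wherever CylGap fails; no attack.
-/

namespace SRD

open Literature.Probability.LatticeModels (IsOSReconstructible IsBoundedMeasurable positiveEvents
  TransferData)

/-- Odd torus sides are never zero. [folklore] -/
instance instNeZeroOddSide (S : ℕ) : NeZero (2 * S + 1) := ⟨Nat.succ_ne_zero _⟩

/-- Sites of `ℤ⁴` (time = coordinate `0`). [folklore] -/
local notation "Site4" => Literature.Probability.LatticeModels.Site 4

/-- Positively oriented edges of `ℤ⁴`. [folklore] -/
local notation "Edge4" => Literature.MathematicalPhysics.QuantumLattice.ZdEdge 4

section Defs

variable {G : Type} [Group G] [TopologicalSpace G] [IsTopologicalGroup G] [CompactSpace G]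
  [MeasurableSpace G] [BorelSpace G]

/-! ### H at one coupling, and the Euclidean-time structure of `ℤ⁴` gauge configurations -/

/-- **H at one coupling `β` with rate `m`** (the atom of the crux's hypothesis, = the disprover's
`EC G r β` with the rate exposed): per-pair constants, ALL symmetric odd tori, `n ≤ S`. [folklore] -/
def TorusEC (r : LatticeRep G) (β m : ℝ) : Prop :=
  ∀ A B : YMSpecies G, ∃ C : ℝ, ∀ S n : ℕ, n ≤ S →
    |latticeConnectedCorr r.ρ β (2 * S + 1) A.F B.F n| ≤ C * Real.exp (-(m * n))

/-- Bond time reflection of sites, `x₀ ↦ -1 - x₀` (plane `x₀ = -1/2`, exchanging `{x₀ ≥ 0}` and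
`{x₀ ≤ -1}`; Osterwalder–Seiler 1978 §2, tree `latticeTimeReflection`). [folklore] -/
def siteReflect (x : Site4) : Site4 := Function.update x 0 (-1 - x 0)

/-- The induced reflection `Θ` of gauge configurations on `ℤ⁴`: spatial edges are carried along;
the temporal edge `(x, 0)` from `x` to `x + e₀` goes to the REVERSED temporal edge from `θx` to
`θx - e₀ = θ(x + e₀)`, whence the inverse (same convention as Wave 0's `GaugeConfig.timeReflect`). [folklore] -/
def edgeReflect (U : LGConfig 4 G) : LGConfig 4 G := fun e =>
  if e.2 = 0 then (U (siteReflect (e.1 + Pi.single 0 1), 0))⁻¹ else U (siteReflect e.1, e.2)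

/-- The unit Euclidean time shift `(τU)(x, i) = U(x + e₀, i)` (so `F ∘ τ` reads one step LATER; the
sign of `latticeConnectedCorr`, whose `B` is composed with `configShift (-n e₀)`). [folklore] -/
def edgeShiftTime : LGConfig 4 G → LGConfig 4 G :=
  Literature.MathematicalPhysics.QuantumLattice.configShift (G := G) (-(Pi.single (0 : Fin 4) (1 : ℤ)))

/-- Positive-time edges: those based at sites with `0 ≤ x₀` (spatial edges at times `≥ 0` and temporal
edges from `t ≥ 0` upwards; the temporal edges from `-1` to `0` cross the plane and belong to no half). [folklore] -/
def posEdges : Set Edge4 := {e | 0 ≤ e.1 0}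

variable (G) in
/-- The positive-time σ-algebra `𝓔₊` (cylinder events of `posEdges`). [folklore] -/
abbrev posEvents : MeasurableSpace (LGConfig 4 G) := positiveEvents (S := G) posEdges

/-- Infinite-volume limit states along ODD symmetric tori `(ℤ/(2S_k+1))⁴`, `S_k ↑ ∞` — the tori the
crux's hypothesis speaks about (tree `IsInfiniteVolumeLimitAlong`, sides `L_k + 1 = 2S_k + 1`). [folklore] -/
def oddLimitPoints (r : LatticeRep G) (β : ℝ) : Set (Measure (LGConfig 4 G)) :=
  {μ | ∃ S : ℕ → ℕ, StrictMono S ∧ IsInfiniteVolumeLimitAlong (d := 4) r.ρ β (fun k => 2 * S k) μ}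

/-- **`IVGap r β m` — infinite-volume spectral gap `≥ m` at coupling `β`**: every odd-torus limit state
is Osterwalder–Schrader reconstructible for `(Θ, τ, 𝓔₊)` (tree `IsOSReconstructible`: RP, RP half a
step up, hermitian symmetry, shift symmetry) and its reconstructed transfer data `(T, Ω)` satisfy
`‖T|_{Ω^⊥}‖ ≤ e^{-m}` (tree `TransferData.HasMassGap`).  For a gauge-invariant `μ` the OS space of ALL
positive-time observables is already the physical one (`ι F = ι (PF)`: `F ∘ Θ` and `G` live on
site-disjoint halves, so the gauge average factorises). [folklore] -/
def IVGap (r : LatticeRep G) (β m : ℝ) : Prop :=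
  ∀ (μ : Measure (LGConfig 4 G)) [IsProbabilityMeasure μ], μ ∈ oddLimitPoints r β →
    ∃ h : IsOSReconstructible μ edgeReflect edgeShiftTime (posEvents G), h.transferData.HasMassGap m

/-! ### Asymmetric tori `ℤ_M × (ℤ/N)³` (tree `SlabGauge`) and zero-temperature cylinder states -/

/-- Sites of `ℤ⁴` ↦ sites of the slab `ℤ_M × (ℤ/N)³`: time (coordinate `0`) ↦ the circle `ℤ_M`,
space ↦ the periodic box. [folklore] -/
def slabSite (M N : ℕ) (y : Site4) : SlabGauge.Site 3 M N :=
  (((y 0 : ℤ) : ZMod M), fun i : Fin 3 => ((y i.succ : ℤ) : ZMod N))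

/-- Directions of `ℤ⁴` ↦ slab directions: `0 ↦ none` (the circle = Euclidean time), `i+1 ↦ some i`. [folklore] -/
def slabDir (i : Fin 4) : SlabGauge.Dir 3 := finSuccEquiv 3 i

/-- The `(M; N, N, N)`-periodic lift of a slab gauge field to `ℤ⁴`. [folklore] -/
def slabLift (M N : ℕ) (U : SlabGauge.Config 3 M N G) : LGConfig 4 G :=
  fun e => U (slabSite M N e.1, slabDir e.2)

/-- The Wilson partition function of the asymmetric torus `M × N³` at coupling `β` (isotropic
`SlabGauge.weight ρ β β = exp (β Σ_P Re tr ρ(U_P))`, normalised Haar; `= Tr T_{V_N}^M`, `T_{V_N} ≥ 0` the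
Osterwalder–Seiler transfer matrix of the spatial 3-torus, for every `M ≥ 1`). [folklore] -/
def slabZ (r : LatticeRep G) (β : ℝ) (M N : ℕ) [NeZero M] [NeZero N] : ℝ :=
  ∫ U, SlabGauge.weight r.ρ β β U ∂(SlabGauge.haar 3 M N G)

/-- Normalised expectation of the asymmetric torus `M × N³`. [folklore] -/
def slabExpect (r : LatticeRep G) (β : ℝ) (M N : ℕ) [NeZero M] [NeZero N]
    (F : SlabGauge.Config 3 M N G → ℝ) : ℝ :=
  (∫ U, F U * SlabGauge.weight r.ρ β β U ∂(SlabGauge.haar 3 M N G)) / slabZ r β M N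

/-- `ω` is the limit of the asymmetric torus states `(M_k + 1) × N³`, `k → ∞`, on bounded continuous
cylinder observables of `ℤ⁴` (through the periodic lift) — the zero-temperature cylinder state
`∞ × (ℤ/N)³` lifted to `ℤ⁴` (spatially `N`-periodic configurations a.s.). [folklore] -/
def IsCylinderLimitAlong (r : LatticeRep G) (β : ℝ) (N : ℕ) [NeZero N] (M : ℕ → ℕ)
    (ω : Measure (LGConfig 4 G)) : Prop :=
  IsProbabilityMeasure ω ∧
    ∀ (F : LGConfig 4 G → ℝ) (Λ : Finset Edge4), IsCylinder F Λ → Continuous F →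
      (∃ C, ∀ U, |F U| ≤ C) →
        Tendsto (fun k : ℕ => slabExpect r β (M k + 1) N (F ∘ slabLift (M k + 1) N)) atTop
          (𝓝 (∫ U, F U ∂ω))

/-- Zero-temperature cylinder states of the spatial torus of side `N` (limit points `M → ∞`; the
transfer-matrix picture makes the limit unique — the vacuum state of `T_{V_N}` — which is part of what
the stubs' provers establish, not assumed). [folklore] -/
def cylinderLimitPoints (r : LatticeRep G) (β : ℝ) (N : ℕ) [NeZero N] : Set (Measure (LGConfig 4 G)) :=
  {ω | ∃ M : ℕ → ℕ, StrictMono M ∧ IsCylinderLimitAlong r β N M ω}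

/-- **`CylGap r β N m` — "gapped in the box"**: every zero-temperature cylinder state of the spatial
torus of side `N` is OS-reconstructible for `(Θ, τ, 𝓔₊)` with transfer gap `≥ m`.  Its OS space is the
whole physical Hilbert space of the spatial 3-torus (time-zero multiplication operators on the
positive vacuum are dense), electric-flux / torelon sectors included — so this IS the statement
`x_i ≤ e^{-m}` for every normalised eigenvalue `x_i = λ_i/λ₀`, `i ≥ 1`, of `T_{V_N}`. [folklore] -/
def CylGap (r : LatticeRep G) (β : ℝ) (N : ℕ) [NeZero N] (m : ℝ) : Prop :=
  ∀ (ω : Measure (LGConfig 4 G)) [IsProbabilityMeasure ω], ω ∈ cylinderLimitPoints r β N →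
    ∃ h : IsOSReconstructible ω edgeReflect edgeShiftTime (posEvents G), h.transferData.HasMassGap m

/-- The top eigenvalue `λ₀(β, N)` of the transfer matrix of the spatial torus of side `N`, defined
WITHOUT operators as `lim inf_M Z_β((M+1) × N³)^{1/(M+1)}` (`‖λ‖_{ℓ^M} ↓ ‖λ‖_∞`: it is the limit). [folklore] -/
def lambda0 (r : LatticeRep G) (β : ℝ) (N : ℕ) [NeZero N] : ℝ :=
  Filter.liminf (fun M : ℕ => (slabZ r β (M + 1) N) ^ (((M : ℝ) + 1)⁻¹)) atTop

/-- **Thermal multiplicity** `ζ_β(M, N³) = Z_β(M × N³)/λ₀^M = Tr t^M = 1 + Σ_{i ≥ 1} x_i^M` of the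
spatial torus of side `N` at inverse temperature `M` (`t = T/λ₀`); `ζ - 1` is the thermal weight of
everything above the vacuum. [folklore] -/
def slabZeta (r : LatticeRep G) (β : ℝ) (M N : ℕ) [NeZero M] [NeZero N] : ℝ :=
  slabZ r β M N / (lambda0 r β N) ^ M

/-- Time extent of a local observable: `1 +` the largest `|x₀|` over the base points of its support
(so `A.F` reads only links inside the time slab `[-c, c]`, `c = timeExtent A`). [folklore] -/
def timeExtent (A : YMSpecies G) : ℕ := A.supp.sup (fun e => (e.1 0).natAbs) + 1

/-- The `β`-UNIFORM large-torus shape of the lattice gap for one `(G, r)` — verbatim the body of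
`EquipartitionCriticality.LatticeGapLargeBeta` / hypothesis 1 of `CriticalContinuumLimit` (8762). [folklore] -/
def UniformTorusGap (r : LatticeRep G) : Prop :=
  ∃ (β₁ : ℝ) (m : ℝ → ℝ) (S₀ : ℝ → ℕ), (∀ β : ℝ, β₁ ≤ β → 0 < m β) ∧
    ∀ A B : YMSpecies G, ∃ C : ℝ, ∀ β : ℝ, β₁ ≤ β → ∀ S n : ℕ, S₀ β ≤ S → n ≤ S →
      |latticeConnectedCorr r.ρ β (2 * S + 1) A.F B.F n| ≤ C * Real.exp (-(m β * n))


/-! ### Vocabulary of the lead's RQ split (measure theory on `G^{edges}`, OS density) -/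

/-- **Approximation property of a measure `μ` on `ℤ⁴` gauge configurations**: every bounded
positive-time-measurable complex observable is an `L²(μ)`-limit of CONTINUOUS bounded cylinder
observables supported on finitely many positive-time edges (true for every probability measure:
`𝓔₊` is generated by the positive-time coordinates, continuous functions are dense in `L²` of a
finite Borel measure on the compact metrisable `G^{Λ}`). [folklore] -/
def CylinderApprox (μ : Measure (LGConfig 4 G)) : Prop :=
  ∀ F : LGConfig 4 G → ℂ, IsBoundedMeasurable (posEvents G) F → ∀ ε : ℝ, 0 < ε →
    ∃ (F' : LGConfig 4 G → ℂ) (Λ : Finset Edge4), (↑Λ : Set Edge4) ⊆ posEdges ∧ IsCylinder F' Λ ∧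
      Continuous F' ∧ Measurable[posEvents G] F' ∧ (∃ C : ℝ, ∀ U, ‖F' U‖ ≤ C) ∧
        ∫ U, ‖F U - F' U‖ ^ 2 ∂μ ≤ ε

variable (G) in
/-- **Probability measures on `ℤ⁴` gauge configurations are determined by their integrals of
bounded continuous real cylinder observables** (Stone–Weierstrass on the compact configuration
space + uniqueness of finite Borel measures from bounded continuous integrals). [folklore] -/
def CylinderExt : Prop :=
  ∀ (μ ν : Measure (LGConfig 4 G)) [IsProbabilityMeasure μ] [IsProbabilityMeasure ν],
    (∀ (F : LGConfig 4 G → ℝ) (Λ : Finset Edge4), IsCylinder F Λ → Continuous F →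
      (∃ C : ℝ, ∀ U, |F U| ≤ C) → ∫ U, F U ∂μ = ∫ U, F U ∂ν) → μ = ν

variable (G) in
/-- The CONTINUOUS positive-time species, read as complex observables: `U ↦ (A.F U : ℂ)` for
`A : YMSpecies G` (bounded measurable gauge-invariant cylinder function) with `A.F` continuous and
`A.supp ⊆ posEdges`. [folklore] -/
def contPosObs : Set (LGConfig 4 G → ℂ) :=
  {F | ∃ A : YMSpecies G, Continuous A.F ∧ (↑A.supp : Set Edge4) ⊆ posEdges ∧
    F = fun U => (A.F U : ℂ)}

end Defs

/-! ### The registered stubs (statements) -/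

namespace Statement

/-- Stub RQ0 — **measure theory on the configuration space**: for a compact simple (hence
second-countable, metrisable) `G`, every probability measure on `LGConfig 4 G` has the
approximation property `CylinderApprox`, and probability measures are determined by their
continuous-cylinder integrals (`CylinderExt`). [folklore] -/
def stub_cylinderApprox : Prop :=
  ∀ (G : Type) [Group G] [TopologicalSpace G] [IsTopologicalGroup G] [CompactSpace G]
    [MeasurableSpace G] [BorelSpace G], IsCompactSimpleLieGroup G →
      (∀ (μ : Measure (LGConfig 4 G)) [IsProbabilityMeasure μ], CylinderApprox μ) ∧ CylinderExt G

/-- Stub RQa — **odd-torus limit states are OS-reconstructible** for the bond time reflection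
`edgeReflect` (`x₀ ↦ -1 - x₀`), the unit time shift `edgeShiftTime` and the positive-time
σ-algebra `posEvents`: RP (`wilsonExpectation_oddReflectionPositive`, translated by one unit) and
RP half a step up (the same theorem conjugated to the site reflection `x₀ ↦ -x₀`:
`edgeReflect = edgeShiftTime ∘ Θ₀`) pass to the limit on continuous cylinder observables and extend
to bounded `𝓔₊`-measurable ones by `CylinderApprox`; hermitian symmetry and shift symmetry are
reflection / translation invariance of the limit state (`CylinderExt`). [folklore] -/
def stub_reconstructible : Prop :=
  ∀ (G : Type) [Group G] [TopologicalSpace G] [IsTopologicalGroup G] [CompactSpace G]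
    [MeasurableSpace G] [BorelSpace G], IsCompactSimpleLieGroup G →
      ∀ (r : LatticeRep G) (β : ℝ), 0 ≤ β →
        ∀ (μ : Measure (LGConfig 4 G)) [IsProbabilityMeasure μ], μ ∈ oddLimitPoints r β →
          CylinderApprox μ → CylinderExt G →
            IsOSReconstructible μ edgeReflect edgeShiftTime (posEvents G)

/-- Stub RQb1 — **OS density of the continuous gauge-invariant positive-time observables**: for an
odd-torus limit state `μ` with the approximation property, the OS images of the complex span of
`contPosObs` are dense in the OS Hilbert space (`ι F = ι (P F)` for the gauge average `P` over the
sites of non-negative time, which do not touch `F ∘ Θ`; gauge invariance of `μ` on continuous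
cylinder functions passes to the limit from `wilsonMeasure_map_gaugeTransform`). [folklore] -/
def stub_osDensity : Prop :=
  ∀ (G : Type) [Group G] [TopologicalSpace G] [IsTopologicalGroup G] [CompactSpace G]
    [MeasurableSpace G] [BorelSpace G], IsCompactSimpleLieGroup G →
      ∀ (r : LatticeRep G) (β : ℝ), 0 ≤ β →
        ∀ (μ : Measure (LGConfig 4 G)) [IsProbabilityMeasure μ], μ ∈ oddLimitPoints r β →
          CylinderApprox μ →
            ∀ h : IsOSReconstructible μ edgeReflect edgeShiftTime (posEvents G),
              Dense (h.osMap '' (Submodule.span ℂ (contPosObs G) : Set (LGConfig 4 G → ℂ)))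

/-- Stub RQb2 — **the gap from H on the dense set** (Glimm–Jaffe 6.1.3 / 19.7.1 in dense form,
tree `gapNorm_le_exp_of_dense_clustering`): H at `β` with rate `m` bounds
`⟪v, Tᵗ v⟫ - |⟪Ω, v⟫|²` by `C_v e^{-mt}` for every `v` in the OS image of the span of `contPosObs`
(pass the torus correlations of the continuous cylinder observables `A ∘ Θ`, `B ∘ τᵗ` to the
limit state; `t ≤ S_k` eventually), hence `‖T P_{Ω^⊥}‖ ≤ e^{-m}`. [folklore] -/
def stub_gapFromClustering : Prop :=
  ∀ (G : Type) [Group G] [TopologicalSpace G] [IsTopologicalGroup G] [CompactSpace G]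
    [MeasurableSpace G] [BorelSpace G], IsCompactSimpleLieGroup G →
      ∀ (r : LatticeRep G) (β m : ℝ), 0 ≤ β → 0 < m → TorusEC r β m →
        ∀ (μ : Measure (LGConfig 4 G)) [IsProbabilityMeasure μ], μ ∈ oddLimitPoints r β →
          ∀ h : IsOSReconstructible μ edgeReflect edgeShiftTime (posEvents G),
            Dense (h.osMap '' (Submodule.span ℂ (contPosObs G) : Set (LGConfig 4 G → ℂ))) →
              h.transferData.HasMassGap m

/-- RQ (no longer a registered stub: the composition of RQ0, RQa, RQb1, RQb2, proved below) —
**infinite-volume spectral re-quantisation**: H at `β` (rate `m`, per-pair constants,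
all odd tori, `n ≤ S`) ⟹ every odd-torus limit state is OS-reconstructible with transfer gap `≥ m`. [folklore] -/
def stub_requantise : Prop :=
  ∀ (G : Type) [Group G] [TopologicalSpace G] [IsTopologicalGroup G] [CompactSpace G]
    [MeasurableSpace G] [BorelSpace G], IsCompactSimpleLieGroup G →
      ∀ (r : LatticeRep G) (β m : ℝ), 0 ≤ β → 0 < m → TorusEC r β m → IVGap r β m

/-- Stub GV — **finite-volume gap stability** ("gapped in the box"): an infinite-volume gap `m ≤ 1`
(H at `β`, at its own rate `m_H`, still available) forces transfer gap `≥ m/2` for the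
zero-temperature cylinder states of all spatial tori of side `2S+1 ≥ 2S₀(β)+1`. [folklore] -/
def stub_gapStability : Prop :=
  ∀ (G : Type) [Group G] [TopologicalSpace G] [IsTopologicalGroup G] [CompactSpace G]
    [MeasurableSpace G] [BorelSpace G], IsCompactSimpleLieGroup G →
      ∀ (r : LatticeRep G) (β mH m : ℝ), 0 ≤ β → 0 < mH → TorusEC r β mH →
        0 < m → m ≤ 1 → IVGap r β m →
          ∃ S₀ : ℕ, ∀ S : ℕ, S₀ ≤ S → CylGap r β (2 * S + 1) (m / 2)

/-- Stub T¼ — **thermal multiplicity at aspect ratio ≥ 1/4** ("cold at a quarter of the period"):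
with a constant `K` depending on `(G, r)` ONLY, for all large spatial tori `N = 2S+1 ≥ 2S₁(β)+1` and
all `M + 1 ≥ N/4`, `ζ_β(M+1, N³) ≤ 1 + K` (given H at `β` at its own rate, the infinite-volume gap
`m ≤ 1` and the cylinder gaps `m/2` beyond `S₀`). [folklore] -/
def stub_thermalMultiplicity : Prop :=
  ∀ (G : Type) [Group G] [TopologicalSpace G] [IsTopologicalGroup G] [CompactSpace G]
    [MeasurableSpace G] [BorelSpace G], IsCompactSimpleLieGroup G →
      ∀ (r : LatticeRep G), ∃ K : ℝ, 0 ≤ K ∧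
        ∀ (β mH m : ℝ) (S₀ : ℕ), 0 ≤ β → 0 < mH → TorusEC r β mH →
          0 < m → m ≤ 1 → IVGap r β m →
          (∀ S : ℕ, S₀ ≤ S → CylGap r β (2 * S + 1) (m / 2)) →
            ∃ S₁ : ℕ, ∀ S : ℕ, S₁ ≤ S → ∀ M : ℕ, 2 * S + 1 ≤ 4 * (M + 1) →
              slabZeta r β (M + 1) (2 * S + 1) ≤ 1 + K

/-- Stub BD — **transfer-matrix block decomposition of the symmetric torus**: the cylinder gap `m/2`
and the thermal bound `1 + K` at aspect `≥ 1/4` give the atoms of 8762's hypothesis 1 on every large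
symmetric odd torus with rate `m/4` and the STRUCTURED, `β`-free constants
`K' (1+K)² C_A C_B e^{c_A + c_B}` (`K'` depends on `(G, r)` only; `c` = `timeExtent`). [folklore] -/
def stub_blockDecomposition : Prop :=
  ∀ (G : Type) [Group G] [TopologicalSpace G] [IsTopologicalGroup G] [CompactSpace G]
    [MeasurableSpace G] [BorelSpace G], IsCompactSimpleLieGroup G →
      ∀ (r : LatticeRep G), ∃ K' : ℝ,
        ∀ (β m K : ℝ) (S₀ S₁ : ℕ), 0 ≤ β → 0 < m → m ≤ 1 → 0 ≤ K →
          (∀ S : ℕ, S₀ ≤ S → CylGap r β (2 * S + 1) (m / 2)) →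
          (∀ S : ℕ, S₁ ≤ S → ∀ M : ℕ, 2 * S + 1 ≤ 4 * (M + 1) →
              slabZeta r β (M + 1) (2 * S + 1) ≤ 1 + K) →
            ∀ (A B : YMSpecies G) (C_A C_B : ℝ), (∀ U, |A.F U| ≤ C_A) → (∀ U, |B.F U| ≤ C_B) →
              ∀ S : ℕ, max S₀ S₁ ≤ S → ∀ n : ℕ, n ≤ S →
                |latticeConnectedCorr r.ρ β (2 * S + 1) A.F B.F n| ≤
                  K' * (1 + K) ^ 2 * C_A * C_B * Real.exp ((timeExtent A : ℝ) + timeExtent B) *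
                    Real.exp (-(m / 4 * n))

end Statement

/-! ### §5a Read-back of the line's vocabulary: the `μ`-free premises of `IsOSReconstructible`
hold for `(edgeReflect, edgeShiftTime, posEvents)` — the time shift reads one step LATER and maps
`𝓔₊` into itself, the reflection is an involution exchanging `𝓔₊` with the edges based at times
`≤ -1` (so at `β = 0` the two halves are independent and every OS space is the vacuum line:
`IVGap r 0 m`, `CylGap r 0 N m` hold for every `m`, `slabZeta r 0 ≡ 1` — the stubs GV/T¼/BD are
consistent at zero coupling, checked on paper, see the module docblock). -/

section ReadBack

variable {G : Type} [Group G] [TopologicalSpace G] [IsTopologicalGroup G] [CompactSpace G]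
  [MeasurableSpace G] [BorelSpace G]

omit [Group G] [TopologicalSpace G] [IsTopologicalGroup G] [CompactSpace G] [BorelSpace G] in
/-- The unit time shift reads one step later: `(τU)(x, i) = U(x + e₀, i)`. [folklore] -/
theorem edgeShiftTime_apply (U : LGConfig 4 G) (e : Edge4) :
    edgeShiftTime U e = U (e.1 + Pi.single 0 1, e.2) := by
  simp [edgeShiftTime, sub_neg_eq_add]

/-- `siteReflect` is an involution. [folklore] -/
theorem siteReflect_siteReflect (x : Site4) : siteReflect (siteReflect x) = x := by
  ext i
  by_cases hi : i = 0
  · subst hi; simp [siteReflect]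
  · simp [siteReflect, hi]

/-- Time coordinate of the reflected site. [folklore] -/
@[simp] theorem siteReflect_apply_zero (x : Site4) : siteReflect x 0 = -1 - x 0 := by
  simp [siteReflect]

/-- Spatial coordinates are untouched by the reflection. [folklore] -/
theorem siteReflect_apply_ne (x : Site4) {i : Fin 4} (hi : i ≠ 0) : siteReflect x i = x i := by
  simp [siteReflect, hi]

/-- `θ(x + e₀) + e₀ = θ x`. [folklore] -/
theorem siteReflect_add_single (x : Site4) :
    siteReflect (x + Pi.single 0 1) + Pi.single 0 1 = siteReflect x := by
  ext i
  by_cases hi : i = 0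
  · subst hi; simp [siteReflect]; ring
  · simp [siteReflect, hi]

omit [TopologicalSpace G] [IsTopologicalGroup G] [CompactSpace G] [MeasurableSpace G]
  [BorelSpace G] in
/-- **The bond reflection is an involution** on gauge configurations (temporal edges are
reversed twice). [folklore] -/
theorem edgeReflect_edgeReflect (U : LGConfig 4 G) : edgeReflect (edgeReflect U) = U := by
  funext e
  obtain ⟨x, i⟩ := e
  by_cases hi : i = 0
  · subst hi
    simp only [edgeReflect, ↓reduceIte, inv_inv]
    rw [siteReflect_add_single, siteReflect_siteReflect]
  · simp [edgeReflect, hi, siteReflect_siteReflect]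

/-- Edges based at Euclidean times `≤ -1` (the reflected half, plus the temporal edges from `-1`
to `0`, which belong to no half). [folklore] -/
def negEdges : Set Edge4 := {e | e.1 0 ≤ -1}

omit [Group G] [TopologicalSpace G] [IsTopologicalGroup G] [CompactSpace G] [BorelSpace G] in
/-- The two half-space edge sets are disjoint (at `β = 0` this makes `F ∘ θ` and `G` independent
for `F, G ∈ 𝓔₊`, whence one-dimensional OS spaces and `gapNorm = 0`). [folklore] -/
theorem disjoint_posEdges_negEdges : Disjoint posEdges negEdges := by
  rw [Set.disjoint_left]
  intro e he hne
  simp only [posEdges, negEdges, Set.mem_setOf_eq] at he hne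
  omega

omit [Group G] [TopologicalSpace G] [IsTopologicalGroup G] [CompactSpace G] [BorelSpace G] in
/-- **The shift maps `𝓔₊` into itself** (the `μ`-free premise `measurable_comp_shift` of
`IsOSReconstructible` for this line's `(τ, 𝓔₊)`): had the sign of `edgeShiftTime` been the other
one, `stub_reconstructible` would be false for EVERY state. [folklore] -/
theorem measurable_comp_edgeShiftTime {F : LGConfig 4 G → ℂ} (hF : Measurable[posEvents G] F) :
    Measurable[posEvents G] (F ∘ edgeShiftTime) := by
  have hτ : @Measurable _ _ (posEvents G) (posEvents G) (edgeShiftTime (G := G)) := by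
    rw [posEvents, Literature.Probability.LatticeModels.positiveEvents,
      MeasureTheory.measurable_cylinderEvents_iff]
    intro e he
    have he' : (e.1 + Pi.single 0 1, e.2) ∈ posEdges := by
      simp only [posEdges, Set.mem_setOf_eq, Pi.add_apply, Pi.single_eq_same] at he ⊢
      omega
    have : (fun U : LGConfig 4 G => edgeShiftTime U e) = fun U => U (e.1 + Pi.single 0 1, e.2) := by
      funext U; exact edgeShiftTime_apply U e
    rw [this]
    exact MeasureTheory.measurable_cylinderEvent_apply he'
  exact @Measurable.comp _ _ _ (posEvents G) (posEvents G) _ _ _ hF hτ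

omit [CompactSpace G] in
/-- **The reflection exchanges the halves**: `F ∈ 𝓔₊ ⇒ F ∘ Θ` is measurable with respect to the
edges based at times `≤ -1`. [folklore] -/
theorem measurable_comp_edgeReflect {F : LGConfig 4 G → ℂ} (hF : Measurable[posEvents G] F) :
    Measurable[Literature.Probability.LatticeModels.positiveEvents (S := G) negEdges]
      (F ∘ edgeReflect) := by
  have hθ : @Measurable _ _ (Literature.Probability.LatticeModels.positiveEvents (S := G) negEdges)
      (posEvents G) (edgeReflect (G := G)) := by
    rw [posEvents, Literature.Probability.LatticeModels.positiveEvents,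
      MeasureTheory.measurable_cylinderEvents_iff]
    intro e he
    simp only [posEdges, Set.mem_setOf_eq] at he
    by_cases hi : e.2 = 0
    · have hmem : (siteReflect (e.1 + Pi.single 0 1), (0 : Fin 4)) ∈ negEdges := by
        simp only [negEdges, Set.mem_setOf_eq, siteReflect_apply_zero, Pi.add_apply,
          Pi.single_eq_same]
        omega
      have : (fun U : LGConfig 4 G => edgeReflect U e) =
          fun U => (U (siteReflect (e.1 + Pi.single 0 1), 0))⁻¹ := by
        funext U; simp [edgeReflect, hi]
      rw [this]
      exact (MeasureTheory.measurable_cylinderEvent_apply hmem).inv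
    · have hmem : (siteReflect e.1, e.2) ∈ negEdges := by
        simp only [negEdges, Set.mem_setOf_eq, siteReflect_apply_zero]
        omega
      have : (fun U : LGConfig 4 G => edgeReflect U e) = fun U => U (siteReflect e.1, e.2) := by
        funext U; simp [edgeReflect, hi]
      rw [this]
      exact MeasureTheory.measurable_cylinderEvent_apply hmem
  exact @Measurable.comp _ _ _ (Literature.Probability.LatticeModels.positiveEvents (S := G)
    negEdges) (posEvents G) _ _ _ hF hθ

end ReadBack

/-! ### §5b `stub_gapStability` (GV) is FALSE for gauge groups with `π₁(G) ≠ 0` — 't Hooft's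
twist sectors (conditional kill; the hypotheses are the standard weak-coupling physics of
`SO(3) = PSU(2)` lattice gauge theory, not constructible in the tree)

GV demands, at every `β ≥ 0` where H holds with an infinite-volume gap `m ≤ 1`, a transfer gap
`≥ m/2` on the WHOLE OS space of the zero-temperature cylinder states `∞ × (ℤ/(2S+1))³` for all
`S ≥ S₀(β)` — "electric-flux / torelon sectors included … `x_i ≤ e^{-m}` for EVERY normalised
eigenvalue" (docstring of `CylGap`).  For a simple `G` with `π₁(G) ≠ 0` (adjoint groups:
`SO(3) = SU(2)/ℤ₂`, `PSU(N)`, `SO(N)`, `E₆/ℤ₃`, …; all satisfy `IsSimpleCompactGroup`, centre-free)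
the physical Hilbert space of the spatial torus carries 't Hooft's MAGNETIC flux
`m ∈ H²(T³; π₁(G)) ≅ π₁(G)³` ['t Hooft, Nucl. Phys. B153 (1979) 141]: in the continuum these are
`|π₁(G)|³` superselection sectors; on the lattice with `G`-valued links they are mixed only by
lattice `π₁(G)`-monopoles.  At weak coupling (beyond the bulk monopole-condensation transition,
Halliday–Schwimmer / Bhanot–Creutz for `SO(3)`):
* the sector vacua are DEGENERATE with the vacuum up to the magnetic-flux free energy, which in a
  massive (confining) phase vanishes like `e^{-σ(β) N²}` ('t Hooft 1979: heavy electric flux ⇔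
  light magnetic flux; numerically de Forcrand–von Smekal hep-lat/0107018), and in a massless
  phase like `1/N` — in NO phase are they gapped uniformly in `N`;
* sector MIXING needs a monopole world-line wrapping a spatial cycle of the torus (a contractible
  monopole loop near the 't Hooft surface only renormalises the bare flux operator, it does not
  change the global class), amplitude `≲ N² L_t e^{-(cβ - log 7) N} → 0` (de Forcrand–Jahn,
  hep-lat/0211004, "twist sectors freeze" in `SO(3)` LGT).
Hence the cylinder transfer matrix `T_{V_N}` of `SO(3)` LGT has `8` eigenvalues with
`λ₇/λ₀ → 1` as `N = 2S+1 → ∞`: `gapNorm → 1` for EVERY large `S`, so `CylGap r β (2S+1) (m/2)`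
fails for all `S ≥ S₀` and every `m > 0` — while H (`TorusEC`, LOCAL gauge-invariant observables
on symmetric tori, blind to global flux up to `e^{-σN²} ≤ e^{-(m/4)n}` for `N ≥ m/(4σ)`) and
`IVGap` (infinite volume: no global sectors; OS images of local observables are dense) are
untouched.  The lead's PICKED.md defuses this by "dynamical ℤ₂ monopoles at `N ≫ e^{cβ}`": that
is the LOCAL breaking (density `e^{-cβ}` of contractible loops), which smears the bare 't Hooft
operator but leaves `⟨W̃(Σ)ψ₀, ψ_flux⟩ ≈ e^{-2ρ N²} ≠ 0`, enough for the NORM `gapNorm`.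

Formal content: the two physical inputs are isolated as precise Props on the line's own
vocabulary — `TwistVacuaDegenerate r β` (cylinder states of arbitrarily large tori whose OS
transfer operator has `gapNorm ≥ 1 - ε`) and `MassivePhase r β` (H at `β` + an infinite-volume OS
gap `≤ 1`, i.e. GV's own hypotheses) — and `stub_gapStability_false_of_twistVacuaDegenerate`
is their checked composition into `¬ Statement.stub_gapStability`.  REPAIR (for the lead; the
crux only ever needs LOCAL observables): quantify the cylinder gap on the orthocomplement of a
`T`-invariant exceptional subspace `E ∋ Ω` of dimension `≤ D(G, r)` (`CylGapModSectors` below,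
`D = |π₁(G)|³` expected) and give BD the sector-blindness of local observables
(`|⟨ιA, P_E ιB⟩ - ⟨ιA, Ω⟩⟨Ω, ιB⟩| ≤ C_A C_B e^{c_A+c_B} e^{-κ(β) N}`, `N ≥ N₂(β)` absorbing
`κ(β) N ≥ (m/4) n`); T¼ survives as typed only because `K(G, r)` is free (`ζ → |π₁(G)|³`, so
`K ≥ |π₁(G)|³ - 1` is forced); BD is vacuously true wherever CylGap fails. -/

section TwistSectors

variable {G : Type} [Group G] [TopologicalSpace G] [IsTopologicalGroup G] [CompactSpace G]
  [MeasurableSpace G] [BorelSpace G]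

/-- **'t Hooft twist degeneracy at `(G, r, β)`** (physical input 1): for every `ε > 0` there are
arbitrarily large spatial tori `(ℤ/(2S+1))³` with a zero-temperature cylinder state whose
Osterwalder–Schrader transfer operator has spectrum in `[1 - ε, 1]` off the vacuum line
(`gapNorm ≥ 1 - ε` for EVERY OS reconstruction of it) — the `|π₁(G)|³ - 1` magnetic-flux vacua
of 't Hooft, Nucl. Phys. B 153 (1979) 141, §3, degenerate with the vacuum as `S → ∞` (flux free
energy `e^{-σN²}` in a confining phase, `O(1/N)` in a Coulomb phase; lattice-monopole tunnelling
`e^{-O(βN)}`, de Forcrand–Jahn, Nucl. Phys. B 651 (2003) 125, hep-lat/0211004).  Expected TRUE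
for every faithful `r` of every simple `G` with `π₁(G) ≠ 0` at all large `β`; FALSE for simply
connected `G` in a massive phase. [cite: tHooft1979, §3] -/
def TwistVacuaDegenerate (r : LatticeRep G) (β : ℝ) : Prop :=
  ∀ ε : ℝ, 0 < ε → ∀ S₀ : ℕ, ∃ S : ℕ, S₀ ≤ S ∧
    ∃ (ω : Measure (LGConfig 4 G)) (_ : IsProbabilityMeasure ω),
      ω ∈ cylinderLimitPoints r β (2 * S + 1) ∧
        ∀ h : IsOSReconstructible ω edgeReflect edgeShiftTime (posEvents G),
          1 - ε ≤ h.transferData.gapNorm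

/-- **Massive phase at `(G, r, β)`** (physical input 2 = GV's own hypotheses at `β`): H at `β`
(volume-uniform clustering of local gauge-invariant observables on the symmetric odd tori, some
rate `m_H > 0`) and an infinite-volume OS gap `m ∈ (0, 1]` for the odd-torus limit states.
Expected TRUE for `SO(3)` LGT at all large `β` (local observables are blind to global flux);
it is exactly what the crux's hypothesis asserts for this `(G, r)` beyond `β₀`, re-quantised by
the line's RQ. [folklore] -/
def MassivePhase (r : LatticeRep G) (β : ℝ) : Prop :=
  (∃ mH : ℝ, 0 < mH ∧ TorusEC r β mH) ∧ ∃ m : ℝ, 0 < m ∧ m ≤ 1 ∧ IVGap r β m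

/-- **GV is false as soon as one admissible `(G, r, β)` has degenerate twist vacua in a massive
phase** (checked composition; the physics is in the two named hypotheses): GV's `S₀` meets a
larger torus whose cylinder state has `gapNorm ≥ 1 - ε > e^{-m/2} ≥ gapNorm`. [folklore] -/
theorem stub_gapStability_false_of_twistVacuaDegenerate (hG : IsCompactSimpleLieGroup G)
    (r : LatticeRep G) {β : ℝ} (hβ : 0 ≤ β) (hT : TwistVacuaDegenerate r β)
    (hM : MassivePhase r β) : ¬ Statement.stub_gapStability := by
  intro hGV
  obtain ⟨⟨mH, hmH, hEC⟩, m, hm, hm1, hIV⟩ := hM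
  obtain ⟨S₀, hS₀⟩ := hGV G hG r β mH m hβ hmH hEC hm hm1 hIV
  have hexp : Real.exp (-(m / 2)) < 1 := Real.exp_lt_one_iff.2 (by linarith)
  obtain ⟨S, hS, ω, hω, hmem, hgap⟩ := hT ((1 - Real.exp (-(m / 2))) / 2) (by linarith) S₀
  obtain ⟨h, hgap'⟩ := hS₀ S hS ω hmem
  have h1 := hgap h
  have h2 := hgap'.2
  linarith

/-- Contrapositive, the form the lead can use: under GV, every admissible `(G, r, β)` in a
massive phase has its cylinder transfer gaps bounded AWAY from `0` uniformly in the volume — so a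
proof of GV must in particular exclude 't Hooft's light magnetic flux for `SO(3)`, i.e. prove
that `SO(3)` lattice gauge theory at weak coupling is NOT massive (refuting the crux's hypothesis
for `SO(3)`, which would make the whole crux vacuously true, §0 `crux_of_not_latticeClustering`).
[folklore] -/
theorem not_twistVacuaDegenerate_of_stub_gapStability (hGV : Statement.stub_gapStability)
    (hG : IsCompactSimpleLieGroup G) (r : LatticeRep G) {β : ℝ} (hβ : 0 ≤ β)
    (hM : MassivePhase r β) : ¬ TwistVacuaDegenerate r β :=
  fun hT => stub_gapStability_false_of_twistVacuaDegenerate hG r hβ hT hM hGV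

open scoped InnerProductSpace in
/-- **One slow positive-time mode excludes a mass gap** (general OS-reconstruction fact, the
checkable form of "a near-degenerate vacuum"): if a bounded positive-time observable `F` of mean
zero has OS autocorrelations `Re b(F, F ∘ τⁿ) ≥ c e^{-δ n}` for all `n`, with `c > 0`, then the
reconstructed transfer data have no mass gap `m > δ` (by `‖⟪ιF, Tⁿ ιF⟫‖ ≤ ‖ιF‖² e^{-mn}` under
`HasMassGap m`, `⟪Ω, ιF⟫ = ∫ F = 0`). For the twist sectors, `F` = the dressed 't Hooft flux
indicator of the time-zero links minus its mean, `δ = ΔE(N) → 0`. [folklore] -/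
theorem not_hasMassGap_of_slowMode {Ω : Type*} {mΩ : MeasurableSpace Ω} {μ : Measure Ω}
    [IsProbabilityMeasure μ] {reflect shift : Ω → Ω} {mpos : MeasurableSpace Ω}
    (h : IsOSReconstructible μ reflect shift mpos) {F : Ω → ℂ} (hF : IsBoundedMeasurable mpos F)
    (hmean : ∫ ω, F ω ∂μ = 0) {c δ : ℝ} (hc : 0 < c)
    (hslow : ∀ n : ℕ, c * Real.exp (-(δ * n)) ≤
      (Literature.Probability.LatticeModels.osForm μ reflect F (F ∘ shift^[n])).re)
    {m : ℝ} (hm : δ < m) : ¬ h.transferData.HasMassGap m := by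
  intro hgap
  have hΩ : ⟪h.transferData.vacuum, h.osMap F⟫_ℂ = 0 := by
    rw [← h.isOSRealisation.integral_eq_inner_vacuum hF, hmean]
  set K : ℝ := ‖h.osMap F‖ * ‖h.osMap F‖ with hKdef
  have hK : 0 ≤ K := mul_nonneg (norm_nonneg _) (norm_nonneg _)
  have hbound : ∀ n : ℕ, c * Real.exp (-(δ * n)) ≤ K * Real.exp (-m * n) := by
    intro n
    have h1 := hgap.norm_inner_pow_apply_sub_le (h.osMap F) (h.osMap F) n
    rw [hΩ, mul_zero, sub_zero] at h1
    have h2 : ⟪h.osMap F, (h.transferData.T ^ n) (h.osMap F)⟫_ℂ =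
        Literature.Probability.LatticeModels.osForm μ reflect F (F ∘ shift^[n]) := by
      rw [IsOSReconstructible.transferData_T, h.inner_osMap_transfer_pow_osMap hF hF n,
        Literature.Probability.LatticeModels.osForm_def]
      rfl
    calc c * Real.exp (-(δ * n))
        ≤ (Literature.Probability.LatticeModels.osForm μ reflect F (F ∘ shift^[n])).re := hslow n
      _ ≤ ‖Literature.Probability.LatticeModels.osForm μ reflect F (F ∘ shift^[n])‖ :=
          Complex.re_le_norm _
      _ = ‖⟪h.osMap F, (h.transferData.T ^ n) (h.osMap F)⟫_ℂ‖ := by rw [h2]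
      _ ≤ K * Real.exp (-m * n) := h1
  have hle : ∀ n : ℕ, c ≤ K * Real.exp (-((m - δ) * n)) := by
    intro n
    have hb := hbound n
    have hpos : 0 < Real.exp (-(δ * n)) := Real.exp_pos _
    have h3 : c ≤ K * Real.exp (-m * n) / Real.exp (-(δ * n)) := by
      rw [le_div_iff₀ hpos]; exact hb
    calc c ≤ K * Real.exp (-m * n) / Real.exp (-(δ * n)) := h3
      _ = K * Real.exp (-((m - δ) * n)) := by
          rw [mul_div_assoc, ← Real.exp_sub]; congr 1; ring_nf
  have hlim : Tendsto (fun n : ℕ => K * Real.exp (-((m - δ) * n))) atTop (𝓝 0) := by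
    have h1 : Tendsto (fun n : ℕ => (m - δ) * (n : ℝ)) atTop atTop :=
      Tendsto.const_mul_atTop (by linarith) tendsto_natCast_atTop_atTop
    have h2 := Real.tendsto_exp_atBot.comp (tendsto_neg_atTop_atBot.comp h1)
    simpa using h2.const_mul K
  have : c ≤ 0 := ge_of_tendsto' hlim hle
  linarith

/-- **Slow flux mode at `(G, r, β)`** — the correlation-function form of 't Hooft's twist
degeneracy (physical input 1′, implies `TwistVacuaDegenerate` in substance): for every rate
`δ > 0` there are arbitrarily large spatial tori with a zero-temperature cylinder state carrying a
mean-zero bounded positive-time observable (the dressed magnetic-flux indicator) whose OS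
autocorrelation decays no faster than `e^{-δ n}`.  For `SO(3)` LGT at weak coupling the flux
autocorrelation time is `1/ΔE(N) ≳ N⁻² e^{(cβ - ln 7) N} → ∞`. [cite: tHooft1979, §3] -/
def SlowFluxMode (r : LatticeRep G) (β : ℝ) : Prop :=
  ∀ δ : ℝ, 0 < δ → ∀ S₀ : ℕ, ∃ S : ℕ, S₀ ≤ S ∧
    ∃ (ω : Measure (LGConfig 4 G)) (_ : IsProbabilityMeasure ω),
      ω ∈ cylinderLimitPoints r β (2 * S + 1) ∧
        ∃ F : LGConfig 4 G → ℂ, IsBoundedMeasurable (posEvents G) F ∧ ∫ U, F U ∂ω = 0 ∧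
          ∃ c : ℝ, 0 < c ∧ ∀ n : ℕ, c * Real.exp (-(δ * n)) ≤
            (Literature.Probability.LatticeModels.osForm ω edgeReflect F (F ∘ edgeShiftTime^[n])).re

/-- **GV is false as soon as one admissible `(G, r, β)` in a massive phase has a slow flux mode**
(checked; `δ := m/4 < m/2`). [folklore] -/
theorem stub_gapStability_false_of_slowFluxMode (hG : IsCompactSimpleLieGroup G)
    (r : LatticeRep G) {β : ℝ} (hβ : 0 ≤ β) (hSF : SlowFluxMode r β) (hM : MassivePhase r β) :
    ¬ Statement.stub_gapStability := by
  intro hGV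
  obtain ⟨⟨mH, hmH, hEC⟩, m, hm, hm1, hIV⟩ := hM
  obtain ⟨S₀, hS₀⟩ := hGV G hG r β mH m hβ hmH hEC hm hm1 hIV
  obtain ⟨S, hS, ω, hω, hmem, F, hF, hmean, c, hc, hslow⟩ := hSF (m / 4) (by positivity) S₀
  obtain ⟨h, hgap⟩ := hS₀ S hS ω hmem
  exact not_hasMassGap_of_slowMode h hF hmean hc hslow (by linarith : m / 4 < m / 2) hgap

/-- **Suggested repair of `CylGap` (for the lead): the cylinder gap MODULO a bounded number of
sector vacua.**  There is an orthogonal projection `P` of finite rank `≤ D`, commuting with the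
transfer operator and fixing the vacuum, off whose range `T` is contracted by `e^{-m}`
(`D = 1`, `P = |Ω⟩⟨Ω|` is `HasMassGap m`; `D = |π₁(G)|³` is what 't Hooft's sectors allow).
BD then needs, in addition, the sector-blindness of LOCAL observables
(`|⟨ιA, P ιB⟩ - ⟨ιA, Ω⟩⟨Ω, ιB⟩| ≤ C_A C_B e^{c_A + c_B} e^{-κ N}`), which is where the
confinement-type input `e^{-σ N²}` enters. [folklore] -/
def CylGapModSectors (r : LatticeRep G) (β : ℝ) (N : ℕ) [NeZero N] (D : ℕ) (m : ℝ) : Prop :=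
  ∀ (ω : Measure (LGConfig 4 G)) [IsProbabilityMeasure ω], ω ∈ cylinderLimitPoints r β N →
    ∃ h : IsOSReconstructible ω edgeReflect edgeShiftTime (posEvents G),
      ∃ P : h.Space →L[ℂ] h.Space, IsSelfAdjoint P ∧ P ∘L P = P ∧
        FiniteDimensional ℂ (LinearMap.range P.toLinearMap) ∧
        Module.finrank ℂ (LinearMap.range P.toLinearMap) ≤ D ∧
        P ∘L h.transferData.T = h.transferData.T ∘L P ∧
        P h.transferData.vacuum = h.transferData.vacuum ∧
        0 < m ∧ ‖h.transferData.T ∘L (1 - P)‖ ≤ Real.exp (-m)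

open scoped InnerProductSpace in
/-- **Sanity of the repair: `D = 1` is the old notion.**  `CylGap` implies `CylGapModSectors` with
the rank-one exceptional subspace `ℂ ∙ Ω` (`P = |Ω⟩⟨Ω|`, `‖T(1 - P)‖ = gapNorm`). [folklore] -/
theorem cylGapModSectors_one_of_cylGap (r : LatticeRep G) (β : ℝ) (N : ℕ) [NeZero N] {m : ℝ}
    (hC : CylGap r β N m) : CylGapModSectors r β N 1 m := by
  intro ω _ hω
  obtain ⟨h, hm, hgap⟩ := hC ω hω
  refine ⟨h, (ℂ ∙ h.transferData.vacuum).starProjection, isSelfAdjoint_starProjection _,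
    (Submodule.isIdempotentElem_starProjection _).eq, ?_, ?_, ?_, ?_, hm, ?_⟩
  · -- the range is the vacuum line, finite-dimensional
    have hr : LinearMap.range ((ℂ ∙ h.transferData.vacuum).starProjection).toLinearMap =
        (ℂ ∙ h.transferData.vacuum) := Submodule.range_starProjection _
    rw [hr]; infer_instance
  · have hr : LinearMap.range ((ℂ ∙ h.transferData.vacuum).starProjection).toLinearMap =
        (ℂ ∙ h.transferData.vacuum) := Submodule.range_starProjection _
    rw [hr, finrank_span_singleton]
    rw [← norm_ne_zero_iff, h.transferData.norm_vacuum]; exact one_ne_zero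
  · -- `P` commutes with the self-adjoint `T` fixing `Ω`
    ext v
    simp only [ContinuousLinearMap.coe_comp, Function.comp_apply]
    rw [Submodule.starProjection_singleton, Submodule.starProjection_singleton,
      h.transferData.norm_vacuum, map_smul, h.transferData.map_vacuum]
    congr 2
    rw [IsOSReconstructible.transferData_T, IsOSReconstructible.transferData_vacuum,
      ← h.inner_transfer_left, h.transfer_vacuum]
  · exact Submodule.starProjection_eq_self_iff.mpr (Submodule.mem_span_singleton_self _)
  · rw [← Submodule.starProjection_orthogonal']
    exact hgap

end TwistSectors


end SRD

end Summit.QuantumFields.YangMills.Cruxes.ClusteringToYangMills.Disproof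

end
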